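import Literature.MathematicalPhysics.KineticTheory.ZeroWavenumberSpace
import Literature.MathematicalPhysics.KineticTheory.PinnedChainCollisionOperator
import HarnessLib

/-!
# The chaos (second-quantisation) picture of the zero-wavenumber space of the harmonic chain

Topic `Literature/MathematicalPhysics/KineticTheory`; definition request `defn-HarmonicChaosDecomposition`
(wanted by `stmt-AtomisticToContinuum-12594`, crux MourreDissolution of route EmbeddedDrudeMourre, to type
the layer-2 operator item OddMourreEstimate: the Mourre estimate at frequency `0` in the momentum-reversal-odd
sector lives on this decomposition at `λ = 0`).

The infinite pinned HARMONIC chain is `pinnedChain ω₂ 0 0 γ` (`FouriersLaw.lean`: `U(q) = ω₂q²/2`,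
`V(r) = r²/2`, `ω₂ > 0`; the bath constant `γ` plays no role), with band
`ω(k)² = ω₂ + 2(1 − cos k)` on the Brillouin zone `𝕋 = ℝ/2πℤ` (`PinnedChainKinetic.dispersion`,
`PinnedChainCollisionOperator.lean`; `dispersion ω₂ ↑x = dispersionR ω₂ x` is by `rfl` the band of
`LinearisedPhononCollisionOperator.lean`). At temperature `T > 0` its translation-invariant Gibbs state
`μ₀` is the centred Gaussian measure with `Cov(p_x, p_y) = T δ_{xy}`, `Cov(q_x, q_y) = T G(x − y)`,
`G(x) = ∫_𝕋 cos(kx) ω(k)⁻² dk` (`dk` = Haar probability measure `μ𝕋`), `Cov(q, p) = 0`, and its dynamics is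
the explicit linear flow `q(t) = cos(√A t) q + A^{-1/2} sin(√A t) p`, `A = ω₂ − Δ`. This file gives the CHAOS /
SECOND-QUANTISATION PICTURE of Doyon's zero-wavenumber Hilbert space `ℋ₀(μ₀)` (`ZeroWavenumberSpace.lean`) of
this system: concrete Hilbert spaces and operators (all with bodies, §1–§6), and the hypothesis structure
`HarmonicChaosDecomposition ω₂ γ T` (§7) packaging `μ₀`, the flow and the unitary identification.

## The picture (van Hemmen 1980 §§3–4, Lanford–Lebowitz 1975; Janson 1997 Thms 2.6, 3.9, 4.1, 4.5 for the Gaussian analysis)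

CONVENTIONS (fixed here once and for all; every constant below follows from them).
Fourier: `q̂(k) = Σ_x e^{−ikx} q_x`, `q_x = ∫ e^{ikx} q̂(k) dk`. Normal modes (ALS06 (3.5)–(3.6)):
`a(k) = (ω(k) q̂(k) + i p̂(k))/√(2ω(k))`, so that `a ∘ φ_t = e^{−iω t} a`, `ā ∘ φ_t = e^{+iωt} ā`,
`a ∘ τ_y = e^{iky} a` for the shift `(τ_y σ)_x = σ_{x+y}` (`chainShift`), and momentum reversal
`R : (q, p) ↦ (q, −p)` (`chainReversal`) acts by `a(k) ∘ R = ā(−k)`. Under `μ₀`: `E[a(k) a(k')] = 0` and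
`E[ā(k) a(k')] = W(k) δ(k − k')` with the RAYLEIGH–JEANS WEIGHT `W(k) = T/ω(k)` (`thermalWeight`); the total
energy is `H = ∫ ω |a|² dk` and the total energy current is `Σ_x j_x = ∫ ω ω' |a|² dk`, `ω ω' = sin k`
(computed from `bondCurrentZ`, `j_x = −½(p_x + p_{x+1})(q_{x+1} − q_x)`; ALS06 (3.8)–(3.9) in the angle
variable with the probability measure).

CHAOS EXPANSION. A local polynomial observable is `A = E A + Σ_{(m,n)≠(0,0)} ∫ F_{m,n}(k; k') :Π_{i≤m} ā(k_i) Π_{j≤n} a(k'_j): dk dk'`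
with kernels symmetric in `k ∈ 𝕋^m` and in `k' ∈ 𝕋^n` (Wiener–Itô chaos of the complex Gaussian field, Janson
Thm 2.6 and Example after Thm 4.1: `L²_ℂ = Γ(K ⊕ K̄)`); by Wick's theorem (Janson Thm 3.9)
`Cov(A, B ∘ τ_y) = Σ_{(m,n)} m! n! ∫ F^A_{m,n} conj(F^B_{m,n}) e^{−iy P} Π_i W(k_i) Π_j W(k'_j) dk dk'`,
`P(k; k') = Σ_i k_i − Σ_j k'_j` (`totalMomentum`). Summing over `y ∈ ℤ` (`Σ_y e^{iyP} = δ(P)` for the probability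
Haar measure) gives Doyon's form: `⟨A, B⟩₀ = Σ_{(m,n)≠(0,0)} m! n! ∫_{P = 0} F^A conj(F^B) ΠW dσ_{m,n}`, where
`σ_{m,n}` is the Haar PROBABILITY measure of the ZERO-MOMENTUM SHELL `Shell m n = ker P ⊂ 𝕋^m × 𝕋^n` (a compact
connected abelian group ≅ 𝕋^{m+n−1}; `shellMeasure`). Hence, in the FLAT NORMALISATION used throughout this file
(`Φ_{m,n} = √(m! n!) Π_i √W(k_i) Π_j √W(k'_j) · F_{m,n}|_{P=0}`, `kernelWeight`):

  `ℋ₀(μ₀) ⊗ ℂ ≅ 𝔉_sym`,  `𝔉 = ⊕̂_{(m,n)≠(0,0)} L²(Shell m n, σ_{m,n}; ℂ)` (`ChaosSpace`, a Hilbert sum `lp _ 2`),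

`𝔉_sym` = kernels symmetric under `S_m × S_n` (`chaosSymmetric`), and under this identification
* `U_t = [A] ↦ [A ∘ φ_t]` is multiplication by `exp(i t Ω_{m,n})`, `Ω_{m,n}(k; k') = Σ_i ω(k_i) − Σ_j ω(k'_j)`
  (`sectorPhase`, `chaosKoopman`) — the second quantisation `Γ(e^{itω})` of the one-phonon dynamics (Janson Thm 4.5;
  van Hemmen 1980 §4);
* `Θ = [A] ↦ [A ∘ R]` is `(ΘΦ)_{m,n}(k; k') = Φ_{n,m}(−k'; −k)` (`chaosReversal`; on images of REAL observables,
  which satisfy the reality condition `Φ_{n,m}(k'; k) = conj Φ_{m,n}(k; k')`, this is `Φ ↦ conj Φ(−k; −k')`), so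
  `P_odd = ½(1 − Θ)`, `P_even = ½(1 + Θ)` are explicit (`chaosOddProj`, `chaosEvenProj`; on `ℋ₀`:
  `ZeroWavenumberData.oddProj/evenProj`);
* the class of the Wick monomial `:φ(f_1) ⋯ φ(f_N):` of linear observables `φ(f) = Σ_x (f^q_x q_x + f^p_x p_x)`
  (`linObs`, `wick`, Wick-ordered with the thermal covariance `thermalCov`, Janson Thm 3.15) is the family of SHELL
  RESTRICTIONS of symmetrised products of THERMAL ONE-PHONON WAVE FUNCTIONS
  `w_f(k) = √W(k) · (coefficient of a(k) in φ(f)) = √(T/2) Σ_x e^{ikx} (f^q_x/ω(k) − i f^p_x)` (`thermalWave`):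
  `Φ_{m,n} = (m! n!)^{-1/2} Σ_{β : Fin m ⊕ Fin n ≃ Fin N} Π_i w̄_{f_{β(inl i)}}(k_i) Π_j w_{f_{β(inr j)}}(k'_j)`
  (`wickKernel`, `wickVector`; zero unless `m + n = N`); these classes are dense, which pins the identification;
* the ONE-PHONON-CHARGE SECTOR `(1,1)`: `Shell 1 1 = {k = k'} ≅ 𝕋`, `Ω_{1,1} ≡ 0` (`sectorPhase_one_one`: the sector
  lies in the kernel of the free generator — the infinitely degenerate embedded eigenvalue `0`), and
  `L²(Shell 1 1) ≅ L²(𝕋, dk)` (`onePhonon`); a profile `Φ_{1,1}(k; k) = g(k)` is the class of the "density of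
  `∫ (g/W)(k) |a(k)|² dk`", i.e. in the requester's weighted normalisation the sector is `L²(𝕋, W² dk) ∋ g/W`;
  the current class `[J] = [j_0]` has profile `T ω'(k) = T sin k/ω(k)` (`currentProfile`, `= T ·` the tree's
  `currentWeight`; physical kernel `g_J/W… = ω ω' = sin k`) and the energy class `[h] = [h_0]` has the constant profile
  `T` (physical kernel `ω`); both are purely `(1,1)` (their `(2,0)`/`(0,2)` shell components cancel — energy and
  total current are conserved by the harmonic flow), `[J]` is `Θ`-odd and `[h]` is `Θ`-even
  (`chaosReversal_currentVector`, `chaosReversal_energyVector`), and `‖[J]‖₀² = T² ∫ ω'² dk`, `‖[h]‖₀² = T²`.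

## Contents

* §1 `SectorConfig m n = 𝕋^m × 𝕋^n`, `totalMomentum`, the shell `Shell m n` (closed subgroup; compact abelian
  group), its Haar probability measure `shellMeasure`, and the lemma that continuous group isomorphisms of compact
  groups preserve Haar probability measures (`measurePreserving_addEquiv`); shell symmetries `shellPerm`
  (relabelling), `shellFlip : (k; k') ↦ (−k'; −k)`, negation — all measure preserving; `sectorPhase`.
* §2 Multiplication by a phase `exp(iθ)` as a unitary of `L²(ν; ℂ)` (`phaseMul`, `phaseEquiv`, Hölder action of
  `L∞`); the sector spaces `SectorSpace m n = Lp ℂ 2 (shellMeasure m n)`, `sectorKoopman` (group law),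
  `sectorPerm`, the closed `symmetricSubspace`, `sectorReversal` (involutive, `Θ U_t = U_{-t} Θ`), `toL2C`.
* §3 `SectorIndex = {(m,n) ≠ (0,0)}`, `ChaosSpace = lp SectorFamily 2` (complex Hilbert space), the reindexed
  diagonal action `ChaosSpace.map`, `chaosKoopman ω₂ t : 𝔉 ≃ₗᵢ[ℂ] 𝔉` (group), `chaosReversal : 𝔉 ≃ₗᵢ[ℂ] 𝔉`
  (involution), `chaosSymmetric` (closed), `chaosOddProj`, `chaosEvenProj` (idempotent, complementary, `Θ`-eigen).
* §4 Wick calculus of the harmonic chain: `TestFn`, `linObs`, `greenFn`, `thermalCov`, `wick` (recursion),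
  `thermalWeight`, `thermalWave`, `kernelWeight`, `wickKernel` (symmetric: `wickKernel_shellPerm`; continuous for
  `ω₂ > 0`), `wickVector` (`∈ chaosSymmetric`).
* §5 The one-phonon-charge sector: `diagShell : 𝕋 ≃+ Shell 1 1` (measure preserving), `onePhonon :
  L²(𝕋) ≃ₗᵢ[ℂ] SectorSpace 1 1`, `onePhononVector`, `currentProfile/energyProfile`, `currentVector/energyVector`,
  PROVED: `U⁰_t` fixes the sector, `Θ` acts by `k ↦ −k`, current odd / energy even, parity projections.
* §6 The explicit harmonic propagator kernels `propCos`, `propSin`, `propCosDeriv`; parity projections on `ℋ₀`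
  for any `ZeroWavenumberData` with `HasMomentumReversal` (`oddProj/evenProj`, `P_odd [J] = [J]`, `P_odd [h] = 0`).
* §7 The hypothesis structure `HarmonicChaosDecomposition ω₂ γ T` and its API (`koopman_currentClass`:
  `U_t [J] = [J]` — the Drude atom; `currentDrudeWeight_eq`: ballistic; `energyConserved`; `iso_oddProj`;
  `norm_currentClass`).

## What is NOT here (and why)

* NO INSTANCE of `HarmonicChaosDecomposition` is constructed: the Gaussian DLR state on `ℤ → ℝ × ℝ`, the tempered
  carrier and its flow, space-time summable clustering of the flow-stable observable space, strong continuity and the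
  isometry `ℋ₀ ≅ 𝔉_sym` are the analytic content of van Hemmen 1980 / Lanford–Lebowitz 1975 / Spohn–Lebowitz 1977
  transcribed to Doyon's `ℋ₀` — the `λ = 0` case of the requesting route's crux ZeroWavenumberFramework — and are the
  DATA/FIELDS of the structure, exactly as for `ZeroWavenumberData` and `HardSphereFluctuationData`. Every field is a
  property of the actual harmonic system derived above; two fields (`iso_currentClass`, `iso_energyClass`) are
  CONSEQUENCES of `iso_fluct_wick` (by the `(1,1)`/`(2,0)` computation recorded above) kept as fields because the
  finite combinatorics of `Σ_{β : Fin 1 ⊕ Fin 1 ≃ Fin 2}` is not worth 200 lines here; they make the API lemmas of §7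
  unconditional.
* No creation/annihilation operators, `dΓ(v i∂_k)` (the sibling request SecondQuantisedVectorField), no Liouvillian
  perturbation `{W, ·}` of the anharmonic chain, no Mourre theory.
* van Hemmen 1980 and Lanford–Lebowitz 1975 are cited at the requester's locators (§§3–4); neither text is held
  (acquisition requests acq-03811, acq-03815); the Gaussian-analysis statements actually used are Janson 1997
  Thm 2.6 (chaos decomposition), Thm 3.9 (covariance of Wick products), Thm 3.15 (recursion), Thm 4.1 (Segal
  isomorphism), Thm 4.5 (`Γ(A)`), which are held and were read.

## Design notes / junk values

* Flat normalisation: sector spaces are `L²` of PROBABILITY measures independent of `(ω₂, T)`; all weights sit in the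
  (explicit) Wick-kernel map. `(m! n!)^{-1/2}` and `√W` are real square roots (`Real.sqrt`, junk for `ω₂ ≤ 0`).
* `toL2C ν f` is the `L²` class of `f` with junk `0` off `L²` (all kernels here are continuous for `ω₂ > 0`).
* `Shell m n` for `m + n = 1` is a point (Dirac measure), for `(0,0)` excluded (`SectorIndex`).
* Scalars: `ℋ₀` is real (Doyon/Mathlib covariance); `𝔉` is complex; `ι = iso` is REAL-linear isometric with
  `Im ⟪ι ψ, ι φ⟫_ℂ = 0` and `ι(ℋ₀) ⊕ iι(ℋ₀) = 𝔉_sym` (fields), i.e. `ι ⊗ ℂ` is unitary onto `𝔉_sym`.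
* `Fact (0 < 2π)` is the scoped instance of `PinnedChainKinetic` (opened here).

## References

* J. L. van Hemmen, Dynamics and ergodicity of the infinite harmonic crystal, Phys. Rep. 65 (1980) 43–149,
  §§3–4. [cite: vanHemmen1980, §§3–4]
* O. E. Lanford, J. L. Lebowitz, Time evolution and ergodic properties of harmonic systems, LNP 38 (1975).
  [cite: LanfordLebowitz1975]
* S. Janson, Gaussian Hilbert Spaces (1997), Thms 2.6, 3.9, 3.15, 4.1, 4.5. [cite: Janson1997, Thms 2.6, 3.9, 4.1]
* B. Doyon, CMP 391 (2022), §4 (the space `ℋ₀`). [cite: Doyon2022, §4]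
* K. Aoki, J. Lukkarinen, H. Spohn, JSP 124 (2006), arXiv:cond-mat/0602082, §3 eqs. (3.4)–(3.12) (band, normal
  modes `a(k)`, `ȧ = −iωa`, `H_har = ∫ ω a*a`, `J_tot = ∫ (2π)⁻¹ω'ω a*a`, the Gaussian covariance `W`).
  [cite: AokiLukkarinenSpohn2006, eqs. (3.5)–(3.12)]
-/

noncomputable section

open MeasureTheory ProbabilityTheory Filter Topology Set Function
open scoped InnerProductSpace ENNReal ComplexConjugate

namespace Literature.MathematicalPhysics.KineticTheory.HeatConduction

open PinnedChainKinetic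

namespace HarmonicChaos

/-! ## §1. Momentum configurations, the zero-momentum shells and their symmetries -/

/-- Momenta of `m` created (`ā`) and `n` annihilated (`a`) phonons: `(k; k') ∈ 𝕋^m × 𝕋^n`, a compact
abelian group. [folklore] -/
abbrev SectorConfig (m n : ℕ) : Type := (Fin m → 𝕋) × (Fin n → 𝕋)

/-- The **total momentum** `P(k; k') = Σ_i k_i − Σ_j k'_j ∈ 𝕋` of the monomial `Π ā(k_i) Π a(k'_j)`
(its character under the lattice shifts: `∘ τ_y` multiplies it by `e^{−iyP}`), a continuous group
homomorphism. [folklore] -/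
def totalMomentum (m n : ℕ) : SectorConfig m n →+ 𝕋 where
  toFun κ := ∑ i, κ.1 i - ∑ j, κ.2 j
  map_zero' := by simp
  map_add' κ κ' := by
    simp only [Prod.fst_add, Prod.snd_add, Pi.add_apply, Finset.sum_add_distrib]
    abel

/-- `P(k; k') = Σ_i k_i − Σ_j k'_j`. [folklore] -/
theorem totalMomentum_apply (m n : ℕ) (κ : SectorConfig m n) :
    totalMomentum m n κ = ∑ i, κ.1 i - ∑ j, κ.2 j := rfl

/-- `P` is continuous. [folklore] -/
theorem continuous_totalMomentum (m n : ℕ) : Continuous (totalMomentum m n) := by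
  change Continuous fun κ : SectorConfig m n => ∑ i, κ.1 i - ∑ j, κ.2 j
  exact (continuous_finsetSum _ fun i _ => (continuous_apply i).comp continuous_fst).sub
    (continuous_finsetSum _ fun j _ => (continuous_apply j).comp continuous_snd)

/-- The **zero-momentum shell** `{P = 0}` of the sector `(m, n)` as a (closed) subgroup of `𝕋^m × 𝕋^n`
(the support of `Σ_{y ∈ ℤ} e^{iyP} = δ(P)`: only zero-total-wavenumber monomials survive the sum over
translates in Doyon's form `⟨a, b⟩₀ = Σ_y Cov(a, b ∘ τ_y)`). [cite: Doyon2022, §4] -/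
def shell (m n : ℕ) : AddSubgroup (SectorConfig m n) := (totalMomentum m n).ker

/-- The zero-momentum shell as a type (a compact abelian group `≅ 𝕋^{m+n-1}` for `m + n ≥ 1`, a point for
`m + n ≤ 1`). [folklore] -/
abbrev Shell (m n : ℕ) : Type := ↥(shell m n)

/-- Membership in the shell: `Σ_i k_i − Σ_j k'_j = 0`. [folklore] -/
theorem mem_shell_iff {m n : ℕ} (κ : SectorConfig m n) :
    κ ∈ shell m n ↔ ∑ i, κ.1 i - ∑ j, κ.2 j = 0 := Iff.rfl

/-- The shell is closed. [folklore] -/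
theorem isClosed_shell (m n : ℕ) : IsClosed (shell m n : Set (SectorConfig m n)) :=
  isClosed_singleton.preimage (continuous_totalMomentum m n)

/-- The shell is compact. [folklore] -/
instance instCompactSpaceShell (m n : ℕ) : CompactSpace (Shell m n) :=
  isCompact_iff_compactSpace.mp (isClosed_shell m n).isCompact

/-- The **shell measure** `σ_{m,n}`: the Haar PROBABILITY measure of the compact group `Shell m n` (the
disintegration of `dk dk'` along `P` over the probability Haar measure of `𝕋`, i.e. "`δ(P(k;k')) dk dk'`").
[folklore] -/
def shellMeasure (m n : ℕ) : Measure (Shell m n) := Measure.addHaarMeasure ⊤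

/-- `σ_{m,n}` is a Haar measure. [folklore] -/
instance instIsAddHaarMeasureShellMeasure (m n : ℕ) : (shellMeasure m n).IsAddHaarMeasure := by
  unfold shellMeasure; infer_instance

/-- `σ_{m,n}` is a probability measure. [folklore] -/
instance instIsProbabilityMeasureShellMeasure (m n : ℕ) : IsProbabilityMeasure (shellMeasure m n) :=
  IsProbabilityMeasure.mk Measure.addHaarMeasure_self

/-- **Continuous group isomorphisms of compact groups preserve the Haar probability measures** (the image
is a Haar probability measure; uniqueness). [folklore] -/
theorem measurePreserving_addEquiv {G K : Type*} [AddCommGroup G] [TopologicalSpace G]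
    [IsTopologicalAddGroup G] [MeasurableSpace G] [BorelSpace G] [AddCommGroup K]
    [TopologicalSpace K] [IsTopologicalAddGroup K] [MeasurableSpace K] [BorelSpace K]
    [LocallyCompactSpace K] (μ : Measure G) (ν : Measure K) [μ.IsAddHaarMeasure]
    [IsProbabilityMeasure μ] [ν.IsAddHaarMeasure] [IsProbabilityMeasure ν] (e : G ≃+ K)
    (he : Continuous e) (hs : Continuous e.symm) : MeasurePreserving e μ ν := by
  refine ⟨he.measurable, ?_⟩
  haveI : (Measure.map e μ).IsAddHaarMeasure := AddEquiv.isAddHaarMeasure_map μ e he hs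
  haveI : IsProbabilityMeasure (Measure.map e μ) :=
    Measure.isProbabilityMeasure_map he.measurable.aemeasurable
  exact Measure.isAddHaarMeasure_eq_of_isProbabilityMeasure _ _

section Symmetries

variable {m n m' n' : ℕ}

/-- Restriction to the shells of an additive equivalence of momentum configurations mapping shell to
shell. [folklore] -/
def restrictShell (e : SectorConfig m n ≃+ SectorConfig m' n')
    (h₁ : ∀ κ ∈ shell m n, e κ ∈ shell m' n') (h₂ : ∀ κ ∈ shell m' n', e.symm κ ∈ shell m n) :
    Shell m n ≃+ Shell m' n' where
  toFun κ := ⟨e κ, h₁ κ κ.2⟩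
  invFun κ := ⟨e.symm κ, h₂ κ κ.2⟩
  left_inv κ := Subtype.ext (e.symm_apply_apply κ)
  right_inv κ := Subtype.ext (e.apply_symm_apply κ)
  map_add' κ κ' := Subtype.ext (e.map_add κ κ')

/-- `restrictShell e` is `e` on configurations. [folklore] -/
@[simp] theorem coe_restrictShell (e : SectorConfig m n ≃+ SectorConfig m' n')
    (h₁ : ∀ κ ∈ shell m n, e κ ∈ shell m' n') (h₂ : ∀ κ ∈ shell m' n', e.symm κ ∈ shell m n)
    (κ : Shell m n) : (restrictShell e h₁ h₂ κ : SectorConfig m' n') = e κ := rfl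

/-- Continuity of the restriction. [folklore] -/
theorem continuous_restrictShell (e : SectorConfig m n ≃+ SectorConfig m' n')
    (h₁ : ∀ κ ∈ shell m n, e κ ∈ shell m' n') (h₂ : ∀ κ ∈ shell m' n', e.symm κ ∈ shell m n)
    (he : Continuous e) : Continuous (restrictShell e h₁ h₂) :=
  Continuous.subtype_mk (he.comp continuous_subtype_val) _

/-- Continuity of the inverse restriction. [folklore] -/
theorem continuous_restrictShell_symm (e : SectorConfig m n ≃+ SectorConfig m' n')
    (h₁ : ∀ κ ∈ shell m n, e κ ∈ shell m' n') (h₂ : ∀ κ ∈ shell m' n', e.symm κ ∈ shell m n)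
    (hs : Continuous e.symm) : Continuous (restrictShell e h₁ h₂).symm :=
  Continuous.subtype_mk (hs.comp continuous_subtype_val) _

/-- Relabelling of the momenta within each group, `(k; k') ↦ (k ∘ σ; k' ∘ τ)`. [folklore] -/
def configPerm (σ : Equiv.Perm (Fin m)) (τ : Equiv.Perm (Fin n)) :
    SectorConfig m n ≃+ SectorConfig m n where
  toFun κ := (κ.1 ∘ σ, κ.2 ∘ τ)
  invFun κ := (κ.1 ∘ σ.symm, κ.2 ∘ τ.symm)
  left_inv κ := by ext i <;> simp
  right_inv κ := by ext i <;> simp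
  map_add' _ _ := rfl

/-- Relabelling is continuous. [folklore] -/
theorem continuous_configPerm (σ : Equiv.Perm (Fin m)) (τ : Equiv.Perm (Fin n)) :
    Continuous (configPerm σ τ) :=
  (continuous_pi fun i => (continuous_apply (σ i)).comp continuous_fst).prodMk
    (continuous_pi fun j => (continuous_apply (τ j)).comp continuous_snd)

/-- Relabelling preserves the total momentum. [folklore] -/
theorem totalMomentum_configPerm (σ : Equiv.Perm (Fin m)) (τ : Equiv.Perm (Fin n))
    (κ : SectorConfig m n) : totalMomentum m n (configPerm σ τ κ) = totalMomentum m n κ := by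
  simp only [totalMomentum_apply, configPerm, AddEquiv.coe_mk, Equiv.coe_fn_mk, comp_apply]
  rw [Equiv.sum_comp σ (fun i => κ.1 i), Equiv.sum_comp τ (fun j => κ.2 j)]

/-- **Relabelling of the momenta as an automorphism of the shell** (the action of `S_m × S_n` whose fixed
kernels are the bosonic ones). [folklore] -/
def shellPerm (σ : Equiv.Perm (Fin m)) (τ : Equiv.Perm (Fin n)) : Shell m n ≃+ Shell m n :=
  restrictShell (configPerm σ τ)
    (fun κ hκ => by
      rw [shell, AddMonoidHom.mem_ker] at hκ ⊢
      rw [totalMomentum_configPerm, hκ])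
    (fun κ hκ => by
      rw [shell, AddMonoidHom.mem_ker] at hκ ⊢
      exact (totalMomentum_configPerm σ.symm τ.symm κ).trans hκ)

/-- Created momenta after relabelling. [folklore] -/
theorem shellPerm_apply_fst (σ : Equiv.Perm (Fin m)) (τ : Equiv.Perm (Fin n)) (κ : Shell m n)
    (i : Fin m) : (shellPerm σ τ κ : SectorConfig m n).1 i = (κ : SectorConfig m n).1 (σ i) := rfl

/-- Annihilated momenta after relabelling. [folklore] -/
theorem shellPerm_apply_snd (σ : Equiv.Perm (Fin m)) (τ : Equiv.Perm (Fin n)) (κ : Shell m n)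
    (j : Fin n) : (shellPerm σ τ κ : SectorConfig m n).2 j = (κ : SectorConfig m n).2 (τ j) := rfl

/-- Relabelling preserves the shell measure. [folklore] -/
theorem measurePreserving_shellPerm (σ : Equiv.Perm (Fin m)) (τ : Equiv.Perm (Fin n)) :
    MeasurePreserving (shellPerm σ τ) (shellMeasure m n) (shellMeasure m n) :=
  measurePreserving_addEquiv _ _ _
    (continuous_restrictShell _ _ _ (continuous_configPerm σ τ))
    (continuous_restrictShell_symm _ _ _ (continuous_configPerm σ.symm τ.symm))

/-- `(k; k') ↦ (−k'; −k)` on configurations: the momentum-reversal map between the sectors `(m, n)` and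
`(n, m)` (`Π ā(k_i) Π a(k'_j) ∘ R = Π a(−k_i) Π ā(−k'_j)`). [folklore] -/
def configFlip (m n : ℕ) : SectorConfig m n ≃+ SectorConfig n m where
  toFun κ := (-κ.2, -κ.1)
  invFun κ := (-κ.2, -κ.1)
  left_inv κ := by simp
  right_inv κ := by simp
  map_add' κ κ' := by
    ext i <;> simp only [Prod.snd_add, Prod.fst_add, neg_add, Prod.mk_add_mk, Pi.add_apply,
      Pi.neg_apply]

/-- The flip is continuous. [folklore] -/
theorem continuous_configFlip (m n : ℕ) : Continuous (configFlip m n) :=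
  continuous_snd.neg.prodMk continuous_fst.neg

/-- The flip preserves the total momentum. [folklore] -/
theorem totalMomentum_configFlip (κ : SectorConfig m n) :
    totalMomentum n m (configFlip m n κ) = totalMomentum m n κ := by
  simp only [totalMomentum_apply, configFlip, AddEquiv.coe_mk, Equiv.coe_fn_mk, Pi.neg_apply,
    Finset.sum_neg_distrib]
  abel

/-- **The momentum-reversal map of shells** `Shell m n ≃+ Shell n m`, `(k; k') ↦ (−k'; −k)`. [folklore] -/
def shellFlip (m n : ℕ) : Shell m n ≃+ Shell n m :=
  restrictShell (configFlip m n)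
    (fun κ hκ => by
      rw [shell, AddMonoidHom.mem_ker] at hκ ⊢
      rw [totalMomentum_configFlip, hκ])
    (fun κ hκ => by
      rw [shell, AddMonoidHom.mem_ker] at hκ ⊢
      exact (totalMomentum_configFlip (m := n) (n := m) κ).trans hκ)

/-- First group after the flip: `−k'`. [folklore] -/
theorem shellFlip_apply_fst (κ : Shell m n) (j : Fin n) :
    (shellFlip m n κ : SectorConfig n m).1 j = -(κ : SectorConfig m n).2 j := rfl

/-- Second group after the flip: `−k`. [folklore] -/
theorem shellFlip_apply_snd (κ : Shell m n) (i : Fin m) :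
    (shellFlip m n κ : SectorConfig n m).2 i = -(κ : SectorConfig m n).1 i := rfl

/-- The flip is involutive. [folklore] -/
theorem shellFlip_shellFlip (κ : Shell m n) : shellFlip n m (shellFlip m n κ) = κ := by
  apply Subtype.ext
  simp [shellFlip, configFlip, restrictShell]

/-- The flip preserves the shell measures. [folklore] -/
theorem measurePreserving_shellFlip (m n : ℕ) :
    MeasurePreserving (shellFlip m n) (shellMeasure m n) (shellMeasure n m) :=
  measurePreserving_addEquiv _ _ _
    (continuous_restrictShell _ _ _ (continuous_configFlip m n))
    (continuous_restrictShell_symm _ _ _ (continuous_configFlip n m))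

/-- Momentum negation `κ ↦ −κ` preserves the shell measure. [folklore] -/
theorem measurePreserving_neg (m n : ℕ) :
    MeasurePreserving (fun κ : Shell m n => -κ) (shellMeasure m n) (shellMeasure m n) :=
  measurePreserving_addEquiv _ _ (AddEquiv.neg (Shell m n)) continuous_neg continuous_neg

end Symmetries

/-! ### The free frequencies -/

/-- **The free frequency of the sector `(m, n)`**: `Ω_{m,n}(k; k') = Σ_i ω(k_i) − Σ_j ω(k'_j)` (created
phonons carry `e^{+iωt}`, annihilated ones `e^{−iωt}`); on the shell `(2,2)` this is the resonance function
`ω₁ + ω₂ − ω₃ − ω₄` of the pair collisions. [cite: AokiLukkarinenSpohn2006, eqs. (3.7) and (4.2)] -/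
def sectorPhase (ω₂ : ℝ) {m n : ℕ} (κ : Shell m n) : ℝ :=
  ∑ i, dispersion ω₂ ((κ : SectorConfig m n).1 i) - ∑ j, dispersion ω₂ ((κ : SectorConfig m n).2 j)

/-- `Ω_{m,n}` is continuous. [folklore] -/
theorem continuous_sectorPhase (ω₂ : ℝ) (m n : ℕ) :
    Continuous (sectorPhase ω₂ : Shell m n → ℝ) := by
  unfold sectorPhase
  refine (continuous_finsetSum _ fun i _ => ?_).sub (continuous_finsetSum _ fun j _ => ?_)
  · exact (continuous_dispersion ω₂).comp
      ((continuous_apply i).comp (continuous_fst.comp continuous_subtype_val))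
  · exact (continuous_dispersion ω₂).comp
      ((continuous_apply j).comp (continuous_snd.comp continuous_subtype_val))

/-- `Ω_{m,n}` is measurable. [folklore] -/
theorem measurable_sectorPhase (ω₂ : ℝ) (m n : ℕ) :
    Measurable (sectorPhase ω₂ : Shell m n → ℝ) :=
  (continuous_sectorPhase ω₂ m n).measurable

/-- `Ω_{n,m}(−k'; −k) = −Ω_{m,n}(k; k')` (`ω` is even): the flip reverses time. [folklore] -/
theorem sectorPhase_shellFlip (ω₂ : ℝ) {m n : ℕ} (κ : Shell m n) :
    sectorPhase ω₂ (shellFlip m n κ) = -sectorPhase ω₂ κ := by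
  simp only [sectorPhase, shellFlip_apply_fst, shellFlip_apply_snd, dispersion_neg]
  ring

/-- `Ω_{m,n}` is invariant under relabelling. [folklore] -/
theorem sectorPhase_shellPerm (ω₂ : ℝ) {m n : ℕ} (σ : Equiv.Perm (Fin m)) (τ : Equiv.Perm (Fin n))
    (κ : Shell m n) : sectorPhase ω₂ (shellPerm σ τ κ) = sectorPhase ω₂ κ := by
  simp only [sectorPhase, shellPerm_apply_fst, shellPerm_apply_snd]
  rw [Equiv.sum_comp σ (fun i => dispersion ω₂ ((κ : SectorConfig m n).1 i)),
    Equiv.sum_comp τ (fun j => dispersion ω₂ ((κ : SectorConfig m n).2 j))]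

/-- `Ω_{m,n}(−κ) = Ω_{m,n}(κ)`. [folklore] -/
theorem sectorPhase_neg (ω₂ : ℝ) {m n : ℕ} (κ : Shell m n) :
    sectorPhase ω₂ (-κ) = sectorPhase ω₂ κ := by
  simp only [sectorPhase, AddSubgroup.coe_neg, Prod.fst_neg, Prod.snd_neg, Pi.neg_apply,
    dispersion_neg]

/-! ## §2. Phase multiplication on `L²`, the sector spaces and their free dynamics -/

section Phase

variable {X : Type*} [MeasurableSpace X] (ν : Measure X)

/-- The unimodular function `x ↦ exp(i θ(x))` as an element of `L∞(ν)`. [folklore] -/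
def phaseFn (θ : X → ℝ) (hθ : Measurable θ) : Lp ℂ ∞ ν :=
  (memLp_top_of_bound (f := fun x => Complex.exp (θ x * Complex.I))
    ((Complex.continuous_exp.measurable.comp
      ((Complex.continuous_ofReal.measurable.comp hθ).mul_const Complex.I)).aestronglyMeasurable)
    1 (ae_of_all _ fun x => by
      rw [Complex.norm_exp_ofReal_mul_I])).toLp _

/-- `phaseFn θ = exp(iθ)` a.e. [folklore] -/
theorem coeFn_phaseFn (θ : X → ℝ) (hθ : Measurable θ) :
    phaseFn ν θ hθ =ᵐ[ν] fun x => Complex.exp (θ x * Complex.I) :=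
  MemLp.coeFn_toLp _

/-- **Multiplication by `exp(iθ)`** as a bounded operator on `L²(ν; ℂ)` (Hölder action of `L∞` on `L²`).
[folklore] -/
def phaseMul (θ : X → ℝ) (hθ : Measurable θ) : Lp ℂ 2 ν →L[ℂ] Lp ℂ 2 ν :=
  ((ContinuousLinearMap.mul ℂ ℂ).holderL ν 2 ∞ 2).flip (phaseFn ν θ hθ)

/-- `phaseMul θ g = exp(iθ) · g` a.e. [folklore] -/
theorem coeFn_phaseMul (θ : X → ℝ) (hθ : Measurable θ) (g : Lp ℂ 2 ν) :
    phaseMul ν θ hθ g =ᵐ[ν] fun x => Complex.exp (θ x * Complex.I) * g x := by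
  unfold phaseMul
  simp only [ContinuousLinearMap.flip_apply, ContinuousLinearMap.holderL_apply_apply]
  filter_upwards [(ContinuousLinearMap.mul ℂ ℂ).coeFn_holder (r := 2) g (phaseFn ν θ hθ),
    coeFn_phaseFn ν θ hθ] with x hx hm
  rw [hx, ContinuousLinearMap.mul_apply', hm, mul_comm]

/-- `phaseMul θ` is norm preserving. [folklore] -/
theorem norm_phaseMul (θ : X → ℝ) (hθ : Measurable θ) (g : Lp ℂ 2 ν) :
    ‖phaseMul ν θ hθ g‖ = ‖g‖ := by
  rw [Lp.norm_def, Lp.norm_def]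
  congr 1
  refine eLpNorm_congr_norm_ae ?_
  filter_upwards [coeFn_phaseMul ν θ hθ g] with x hx
  rw [hx, norm_mul, Complex.norm_exp_ofReal_mul_I, one_mul]

/-- Group law: `exp(iθ) · (exp(iθ') · g) = exp(i(θ + θ')) · g`. [folklore] -/
theorem phaseMul_phaseMul (θ θ' : X → ℝ) (hθ : Measurable θ) (hθ' : Measurable θ') (g : Lp ℂ 2 ν) :
    phaseMul ν θ hθ (phaseMul ν θ' hθ' g) = phaseMul ν (θ + θ') (hθ.add hθ') g := by
  apply Lp.ext
  filter_upwards [coeFn_phaseMul ν θ hθ (phaseMul ν θ' hθ' g), coeFn_phaseMul ν θ' hθ' g,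
    coeFn_phaseMul ν (θ + θ') (hθ.add hθ') g] with x h1 h2 h3
  rw [h1, h2, h3, ← mul_assoc, ← Complex.exp_add, Pi.add_apply, Complex.ofReal_add, add_mul]

/-- `exp(i·0) · g = g`. [folklore] -/
theorem phaseMul_zero (g : Lp ℂ 2 ν) : phaseMul ν (fun _ => (0 : ℝ)) measurable_const g = g := by
  apply Lp.ext
  filter_upwards [coeFn_phaseMul ν (fun _ => (0 : ℝ)) measurable_const g] with x hx
  rw [hx, Complex.ofReal_zero, zero_mul, Complex.exp_zero, one_mul]

/-- **Multiplication by `exp(iθ)` as a unitary of `L²(ν; ℂ)`** (inverse: multiplication by `exp(−iθ)`).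
[folklore] -/
def phaseEquiv (θ : X → ℝ) (hθ : Measurable θ) : Lp ℂ 2 ν ≃ₗᵢ[ℂ] Lp ℂ 2 ν where
  toFun := phaseMul ν θ hθ
  invFun := phaseMul ν (-θ) hθ.neg
  map_add' := map_add _
  map_smul' := map_smul _
  left_inv g := by
    rw [phaseMul_phaseMul]
    have h : -θ + θ = fun _ => (0 : ℝ) := by funext x; simp
    simp only [h]
    exact phaseMul_zero ν g
  right_inv g := by
    rw [phaseMul_phaseMul]
    have h : θ + -θ = fun _ => (0 : ℝ) := by funext x; simp
    simp only [h]
    exact phaseMul_zero ν g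
  norm_map' := norm_phaseMul ν θ hθ

/-- `phaseEquiv θ` acts as `phaseMul θ`. [folklore] -/
@[simp] theorem phaseEquiv_apply (θ : X → ℝ) (hθ : Measurable θ) (g : Lp ℂ 2 ν) :
    phaseEquiv ν θ hθ g = phaseMul ν θ hθ g := rfl

end Phase

open Classical in
/-- The `L²(ν; ℂ)` class of a function `f : X → ℂ` (junk value `0` if `f ∉ L²`). [folklore] -/
def toL2C {X : Type*} [MeasurableSpace X] (ν : Measure X) (f : X → ℂ) : Lp ℂ 2 ν :=
  if h : MemLp f 2 ν then h.toLp f else 0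

/-- On `L²`, `toL2C f` is the class of `f`. [folklore] -/
theorem toL2C_eq {X : Type*} [MeasurableSpace X] {ν : Measure X} {f : X → ℂ} (h : MemLp f 2 ν) :
    toL2C ν f = h.toLp f := by
  unfold toL2C; rw [dif_pos h]

/-- `toL2C f = f` a.e. when `f ∈ L²`. [folklore] -/
theorem coeFn_toL2C {X : Type*} [MeasurableSpace X] {ν : Measure X} {f : X → ℂ}
    (h : MemLp f 2 ν) : toL2C ν f =ᵐ[ν] f := by
  rw [toL2C_eq h]; exact h.coeFn_toLp

/-- `toL2C 0 = 0`. [folklore] -/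
@[simp] theorem toL2C_zero {X : Type*} [MeasurableSpace X] (ν : Measure X) :
    toL2C ν (0 : X → ℂ) = 0 := by
  have h : MemLp (0 : X → ℂ) 2 ν := MemLp.zero
  rw [toL2C_eq h]
  exact Lp.ext ((MemLp.coeFn_toLp h).trans (Lp.coeFn_zero ℂ 2 ν).symm)

/-- `toL2C (−f) = −toL2C f` on `L²`. [folklore] -/
theorem toL2C_neg {X : Type*} [MeasurableSpace X] {ν : Measure X} {f : X → ℂ} (h : MemLp f 2 ν) :
    toL2C ν (fun x => -f x) = -toL2C ν f := by
  apply Lp.ext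
  filter_upwards [coeFn_toL2C h, coeFn_toL2C h.neg, Lp.coeFn_neg (toL2C ν f)] with x h1 h2 h3
  rw [h3, Pi.neg_apply, h1]
  exact h2

/-- Continuous functions on a compact shell are in `L²(σ_{m,n})`. [folklore] -/
theorem memLp_two_of_continuous_shell {m n : ℕ} {f : Shell m n → ℂ} (hf : Continuous f) :
    MemLp f 2 (shellMeasure m n) := by
  obtain ⟨C, hC⟩ := isCompact_univ.exists_bound_of_continuousOn hf.continuousOn
  exact (memLp_top_of_bound hf.aestronglyMeasurable C
    (ae_of_all _ fun x => hC x (mem_univ x))).mono_exponent le_top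

/-- Continuous functions on the circle are in `L²(dk; ℂ)`. [folklore] -/
theorem memLp_two_of_continuous_circle {f : 𝕋 → ℂ} (hf : Continuous f) : MemLp f 2 μ𝕋 := by
  obtain ⟨C, hC⟩ := isCompact_univ.exists_bound_of_continuousOn hf.continuousOn
  exact (memLp_top_of_bound hf.aestronglyMeasurable C
    (ae_of_all _ fun x => hC x (mem_univ x))).mono_exponent le_top

/-- `k ↦ −k` preserves the Haar probability measure of the circle. [folklore] -/
theorem measurePreserving_neg_circle : MeasurePreserving (fun k : 𝕋 => -k) μ𝕋 μ𝕋 :=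
  measurePreserving_addEquiv _ _ (AddEquiv.neg 𝕋) continuous_neg continuous_neg

/-! ### Sector spaces -/

/-- **The Hilbert space of the sector `(m, n)`**: `L²(Shell m n, σ_{m,n}; ℂ)` — kernels `Φ_{m,n}(k; k')` of
`m` created and `n` annihilated phonons of zero total momentum, flat normalisation (van Hemmen 1980 §3: the
`(m+n)`-particle subspaces of the Fock space over the one-phonon space, here reduced to wavenumber `0`).
[cite: vanHemmen1980, §3] -/
abbrev SectorSpace (m n : ℕ) : Type := Lp ℂ 2 (shellMeasure m n)

/-- **The free Koopman group on the sector `(m, n)`**: multiplication by `exp(i t Ω_{m,n})` (a unitary).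
[cite: vanHemmen1980, §4] -/
def sectorKoopman (ω₂ : ℝ) (m n : ℕ) (t : ℝ) : SectorSpace m n ≃ₗᵢ[ℂ] SectorSpace m n :=
  phaseEquiv (shellMeasure m n) (fun κ => t * sectorPhase ω₂ κ)
    (measurable_const.mul (measurable_sectorPhase ω₂ m n))

/-- `(U⁰_t Φ)(κ) = exp(i t Ω(κ)) Φ(κ)` a.e. [folklore] -/
theorem coeFn_sectorKoopman (ω₂ : ℝ) {m n : ℕ} (t : ℝ) (F : SectorSpace m n) :
    sectorKoopman ω₂ m n t F =ᵐ[shellMeasure m n]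
      fun κ => Complex.exp (↑(t * sectorPhase ω₂ κ) * Complex.I) * F κ :=
  coeFn_phaseMul _ _ _ F

/-- `U⁰_0 = 1` on a sector. [folklore] -/
theorem sectorKoopman_zero (ω₂ : ℝ) {m n : ℕ} (F : SectorSpace m n) :
    sectorKoopman ω₂ m n 0 F = F := by
  apply Lp.ext
  filter_upwards [coeFn_sectorKoopman ω₂ 0 F] with κ hκ
  rw [hκ, zero_mul, Complex.ofReal_zero, zero_mul, Complex.exp_zero, one_mul]

/-- Group law `U⁰_{s+t} = U⁰_s U⁰_t` on a sector. [folklore] -/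
theorem sectorKoopman_add (ω₂ : ℝ) {m n : ℕ} (s t : ℝ) (F : SectorSpace m n) :
    sectorKoopman ω₂ m n (s + t) F = sectorKoopman ω₂ m n s (sectorKoopman ω₂ m n t F) := by
  apply Lp.ext
  filter_upwards [coeFn_sectorKoopman ω₂ (s + t) F, coeFn_sectorKoopman ω₂ t F,
    coeFn_sectorKoopman ω₂ s (sectorKoopman ω₂ m n t F)] with κ h1 h2 h3
  rw [h1, h3, h2, ← mul_assoc, ← Complex.exp_add]
  congr 1
  push_cast
  ring

/-- Relabelling of momenta as a linear isometry of the sector space, `Φ ↦ Φ ∘ (σ, τ)`. [folklore] -/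
def sectorPerm {m n : ℕ} (σ : Equiv.Perm (Fin m)) (τ : Equiv.Perm (Fin n)) :
    SectorSpace m n →ₗᵢ[ℂ] SectorSpace m n :=
  Lp.compMeasurePreservingₗᵢ ℂ (shellPerm σ τ) (measurePreserving_shellPerm σ τ)

/-- `sectorPerm σ τ Φ = Φ ∘ shellPerm σ τ` a.e. [folklore] -/
theorem coeFn_sectorPerm {m n : ℕ} (σ : Equiv.Perm (Fin m)) (τ : Equiv.Perm (Fin n))
    (F : SectorSpace m n) : sectorPerm σ τ F =ᵐ[shellMeasure m n] fun κ => F (shellPerm σ τ κ) :=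
  Lp.coeFn_compMeasurePreserving F (measurePreserving_shellPerm σ τ)

/-- **The symmetric (bosonic) subspace** of the sector `(m, n)`: kernels invariant under relabelling of the
created and of the annihilated momenta separately (`Sym^m ⊗ Sym^n`). [cite: Janson1997, Thm 4.1] -/
def symmetricSubspace (m n : ℕ) : Submodule ℂ (SectorSpace m n) where
  carrier := {F | ∀ (σ : Equiv.Perm (Fin m)) (τ : Equiv.Perm (Fin n)), sectorPerm σ τ F = F}
  zero_mem' σ τ := map_zero _
  add_mem' {F G} hF hG σ τ := by rw [map_add, hF σ τ, hG σ τ]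
  smul_mem' c F hF σ τ := by rw [LinearIsometry.map_smul, hF σ τ]

/-- Membership in the symmetric subspace. [folklore] -/
theorem mem_symmetricSubspace_iff {m n : ℕ} (F : SectorSpace m n) :
    F ∈ symmetricSubspace m n ↔
      ∀ (σ : Equiv.Perm (Fin m)) (τ : Equiv.Perm (Fin n)), sectorPerm σ τ F = F := Iff.rfl

/-- The symmetric subspace is closed. [folklore] -/
theorem isClosed_symmetricSubspace (m n : ℕ) :
    IsClosed (symmetricSubspace m n : Set (SectorSpace m n)) := by
  have h : (symmetricSubspace m n : Set (SectorSpace m n)) =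
      ⋂ σ : Equiv.Perm (Fin m), ⋂ τ : Equiv.Perm (Fin n), {F | sectorPerm σ τ F = F} := by
    ext F
    simp [mem_symmetricSubspace_iff]
  rw [h]
  exact isClosed_iInter fun σ => isClosed_iInter fun τ =>
    isClosed_eq (sectorPerm σ τ).continuous continuous_id

/-- **The momentum-reversal map between sectors**, `SectorSpace n m → SectorSpace m n`,
`(Θ Φ)_{m,n}(k; k') = Φ_{n,m}(−k'; −k)` (a linear isometry). [folklore] -/
def sectorReversal (m n : ℕ) : SectorSpace n m →ₗᵢ[ℂ] SectorSpace m n :=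
  Lp.compMeasurePreservingₗᵢ ℂ (shellFlip m n) (measurePreserving_shellFlip m n)

/-- `sectorReversal Φ = Φ ∘ shellFlip` a.e. [folklore] -/
theorem coeFn_sectorReversal {m n : ℕ} (F : SectorSpace n m) :
    sectorReversal m n F =ᵐ[shellMeasure m n] fun κ => F (shellFlip m n κ) :=
  Lp.coeFn_compMeasurePreserving F (measurePreserving_shellFlip m n)

/-- The sector reversals are mutually inverse. [folklore] -/
theorem sectorReversal_sectorReversal {m n : ℕ} (F : SectorSpace m n) :
    sectorReversal m n (sectorReversal n m F) = F := by
  have hcomp : (shellFlip n m) ∘ (shellFlip m n) = id := funext shellFlip_shellFlip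
  have h := Lp.compMeasurePreserving_comp_apply (E := ℂ) (p := 2) F
    (measurePreserving_shellFlip n m) (measurePreserving_shellFlip m n)
  change Lp.compMeasurePreserving (shellFlip m n) (measurePreserving_shellFlip m n)
      (Lp.compMeasurePreserving (shellFlip n m) (measurePreserving_shellFlip n m) F) = F
  rw [← h]
  simp only [hcomp]
  exact Lp.compMeasurePreserving_id_apply F

/-- **`U⁰_t Θ = Θ U⁰_{−t}`** between sectors. [folklore] -/
theorem sectorKoopman_sectorReversal (ω₂ : ℝ) {m n : ℕ} (t : ℝ) (F : SectorSpace n m) :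
    sectorKoopman ω₂ m n t (sectorReversal m n F) =
      sectorReversal m n (sectorKoopman ω₂ n m (-t) F) := by
  apply Lp.ext
  have hqmp := (measurePreserving_shellFlip m n).quasiMeasurePreserving
  filter_upwards [coeFn_sectorKoopman ω₂ t (sectorReversal m n F), coeFn_sectorReversal F,
    coeFn_sectorReversal (sectorKoopman ω₂ n m (-t) F),
    hqmp.ae_eq (coeFn_sectorKoopman ω₂ (-t) F)] with κ h1 h2 h3 h4
  rw [h1, h2, h3]
  simp only [Function.comp_apply] at h4
  rw [h4]
  simp only [sectorPhase_shellFlip, mul_neg, neg_mul, neg_neg]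

/-! ## §3. The zero-wavenumber chaos space `𝔉` -/

/-- **Sector labels** `(m, n) ≠ (0, 0)`: numbers of created / annihilated phonons; the sector `(0,0)` (the
constants) is quotiented out by the covariance in Doyon's form. [folklore] -/
abbrev SectorIndex : Type := {p : ℕ × ℕ // p ≠ 0}

namespace SectorIndex

/-- Number of created phonons of a label. [folklore] -/
abbrev cr (s : SectorIndex) : ℕ := s.1.1

/-- Number of annihilated phonons of a label. [folklore] -/
abbrev an (s : SectorIndex) : ℕ := s.1.2

/-- The label `(m, n)`. [folklore] -/
def mk (m n : ℕ) (h : (m, n) ≠ (0, 0)) : SectorIndex := ⟨(m, n), h⟩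

/-- Exchanging created and annihilated numbers keeps `(m, n) ≠ (0, 0)`. [folklore] -/
theorem swap_ne_zero (s : SectorIndex) : (s.1.2, s.1.1) ≠ 0 := fun h =>
  s.2 (Prod.ext (by simpa using congrArg Prod.snd h) (by simpa using congrArg Prod.fst h))

/-- Exchange of created and annihilated phonons on labels, `(m, n) ↦ (n, m)` (reducible, so that
`SectorFamily (swap s)` unfolds to `SectorSpace s.an s.cr`). [folklore] -/
@[reducible] def swap : SectorIndex ≃ SectorIndex where
  toFun s := ⟨(s.1.2, s.1.1), swap_ne_zero s⟩
  invFun s := ⟨(s.1.2, s.1.1), swap_ne_zero s⟩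
  left_inv _ := rfl
  right_inv _ := rfl

/-- `cr (swap s) = an s`. [folklore] -/
@[simp] theorem swap_cr (s : SectorIndex) : (swap s).cr = s.an := rfl

/-- `an (swap s) = cr s`. [folklore] -/
@[simp] theorem swap_an (s : SectorIndex) : (swap s).an = s.cr := rfl

/-- `swap` is an involution. [folklore] -/
@[simp] theorem swap_swap (s : SectorIndex) : swap (swap s) = s := rfl

/-- The label of the one-phonon-charge sector `(1, 1)`. [folklore] -/
abbrev oneOne : SectorIndex := ⟨(1, 1), by simp⟩

/-- `(1, 1)` is `swap`-invariant. [folklore] -/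
@[simp] theorem swap_oneOne : swap oneOne = oneOne := rfl

end SectorIndex

/-- The family of sector spaces indexed by labels. [folklore] -/
abbrev SectorFamily (s : SectorIndex) : Type := SectorSpace s.cr s.an

/-- **The zero-wavenumber chaos space** `𝔉 = ⊕̂_{(m,n) ≠ (0,0)} L²(Shell m n, σ_{m,n}; ℂ)`, the Hilbert sum
(`lp _ 2`) of the sector spaces — the target of the identification `ℋ₀(μ₀) ⊗ ℂ ≅ 𝔉_sym`
(van Hemmen 1980 §§3–4: `L²(μ₀)` = Fock space over the one-phonon space, here reduced to total wavenumber `0`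
by Doyon's form). [cite: vanHemmen1980, §§3–4] -/
abbrev ChaosSpace : Type := lp SectorFamily 2

namespace ChaosSpace

/-- `0 < 2` for the real exponent of `lp _ 2`. [folklore] -/
theorem two_toReal_pos : 0 < (2 : ℝ≥0∞).toReal := by norm_num

/-- A family of sector isometries, reindexed along a bijection of labels, applied to an element of `𝔉`.
[folklore] -/
def mapAux (e : SectorIndex ≃ SectorIndex) (T : ∀ s, SectorFamily (e s) →ₗᵢ[ℂ] SectorFamily s)
    (F : ChaosSpace) : ChaosSpace :=
  ⟨fun s => T s (F (e s)), by
    refine (memℓp_gen_iff two_toReal_pos).2 ?_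
    have h := (memℓp_gen_iff two_toReal_pos).1 (lp.memℓp F)
    simp only [LinearIsometry.norm_map]
    exact (e.summable_iff (f := fun s => ‖F s‖ ^ (2 : ℝ≥0∞).toReal)).2 h⟩

/-- Components of `mapAux`. [folklore] -/
@[simp] theorem mapAux_apply (e : SectorIndex ≃ SectorIndex)
    (T : ∀ s, SectorFamily (e s) →ₗᵢ[ℂ] SectorFamily s) (F : ChaosSpace) (s : SectorIndex) :
    mapAux e T F s = T s (F (e s)) := rfl

/-- **Reindexed diagonal action** of a family of sector isometries on `𝔉` (a linear isometry). [folklore] -/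
def map (e : SectorIndex ≃ SectorIndex) (T : ∀ s, SectorFamily (e s) →ₗᵢ[ℂ] SectorFamily s) :
    ChaosSpace →ₗᵢ[ℂ] ChaosSpace where
  toFun := mapAux e T
  map_add' F G := by
    apply lp.ext; funext s
    simp only [mapAux_apply, lp.coeFn_add, Pi.add_apply, map_add]
  map_smul' c F := by
    apply lp.ext; funext s
    simp only [mapAux_apply, lp.coeFn_smul, Pi.smul_apply, LinearIsometry.map_smul,
      RingHom.id_apply]
  norm_map' F := by
    have h1 := lp.norm_rpow_eq_tsum two_toReal_pos (mapAux e T F)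
    have h2 := lp.norm_rpow_eq_tsum two_toReal_pos F
    simp only [mapAux_apply, LinearIsometry.norm_map] at h1
    rw [e.tsum_eq (fun s => ‖F s‖ ^ (2 : ℝ≥0∞).toReal)] at h1
    rw [← h2] at h1
    have hp : (0 : ℝ) ≤ ‖mapAux e T F‖ := norm_nonneg _
    have hq : (0 : ℝ) ≤ ‖F‖ := norm_nonneg _
    exact Real.rpow_left_injOn two_toReal_pos.ne' hp hq h1

/-- Components of `map`. [folklore] -/
@[simp] theorem map_apply (e : SectorIndex ≃ SectorIndex)
    (T : ∀ s, SectorFamily (e s) →ₗᵢ[ℂ] SectorFamily s) (F : ChaosSpace) (s : SectorIndex) :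
    map e T F s = T s (F (e s)) := rfl

end ChaosSpace

/-- The free Koopman map on `𝔉` as a linear isometry (see `chaosKoopman`). [folklore] -/
def chaosKoopmanMap (ω₂ t : ℝ) : ChaosSpace →ₗᵢ[ℂ] ChaosSpace :=
  ChaosSpace.map (Equiv.refl _) fun s => (sectorKoopman ω₂ s.cr s.an t).toLinearIsometry

/-- Components of `chaosKoopmanMap`. [folklore] -/
@[simp] theorem chaosKoopmanMap_apply (ω₂ t : ℝ) (F : ChaosSpace) (s : SectorIndex) :
    chaosKoopmanMap ω₂ t F s = sectorKoopman ω₂ s.cr s.an t (F s) := rfl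

/-- `U⁰_0 = 1`. [folklore] -/
theorem chaosKoopmanMap_zero (ω₂ : ℝ) (F : ChaosSpace) : chaosKoopmanMap ω₂ 0 F = F := by
  apply lp.ext; funext s
  rw [chaosKoopmanMap_apply, sectorKoopman_zero]

/-- Group law. [folklore] -/
theorem chaosKoopmanMap_add (ω₂ s t : ℝ) (F : ChaosSpace) :
    chaosKoopmanMap ω₂ (s + t) F = chaosKoopmanMap ω₂ s (chaosKoopmanMap ω₂ t F) := by
  apply lp.ext; funext r
  simp only [chaosKoopmanMap_apply, sectorKoopman_add]

/-- **The free Koopman group `U⁰_t` on `𝔉`**: on the sector `(m, n)`, multiplication by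
`exp(i t (Σ_i ω(k_i) − Σ_j ω(k'_j)))` — the second quantisation `Γ(e^{itω})` of the one-phonon dynamics,
to which the identification carries `U_t [A] = [A ∘ φ_t]` (field `iso_koopman`). [cite: vanHemmen1980, §4] -/
def chaosKoopman (ω₂ t : ℝ) : ChaosSpace ≃ₗᵢ[ℂ] ChaosSpace :=
  LinearIsometryEquiv.ofSurjective (chaosKoopmanMap ω₂ t) fun F =>
    ⟨chaosKoopmanMap ω₂ (-t) F, by rw [← chaosKoopmanMap_add, add_neg_cancel, chaosKoopmanMap_zero]⟩

/-- Components of `U⁰_t`. [folklore] -/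
@[simp] theorem chaosKoopman_apply (ω₂ t : ℝ) (F : ChaosSpace) (s : SectorIndex) :
    chaosKoopman ω₂ t F s = sectorKoopman ω₂ s.cr s.an t (F s) := rfl

/-- `U⁰_0 = 1`. [folklore] -/
theorem chaosKoopman_zero (ω₂ : ℝ) (F : ChaosSpace) : chaosKoopman ω₂ 0 F = F :=
  chaosKoopmanMap_zero ω₂ F

/-- **Group law** `U⁰_{s+t} = U⁰_s U⁰_t`. [folklore] -/
theorem chaosKoopman_add (ω₂ s t : ℝ) (F : ChaosSpace) :
    chaosKoopman ω₂ (s + t) F = chaosKoopman ω₂ s (chaosKoopman ω₂ t F) :=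
  chaosKoopmanMap_add ω₂ s t F

/-- Momentum reversal on `𝔉` as a linear isometry (see `chaosReversal`). [folklore] -/
def chaosReversalMap : ChaosSpace →ₗᵢ[ℂ] ChaosSpace :=
  ChaosSpace.map SectorIndex.swap fun s => sectorReversal s.cr s.an

/-- Components of `chaosReversalMap`. [folklore] -/
theorem chaosReversalMap_apply (F : ChaosSpace) (s : SectorIndex) :
    chaosReversalMap F s = sectorReversal s.cr s.an (F (SectorIndex.swap s)) := rfl

/-- `chaosReversalMap` is an involution. [folklore] -/
theorem chaosReversalMap_chaosReversalMap (F : ChaosSpace) :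
    chaosReversalMap (chaosReversalMap F) = F := by
  apply lp.ext; funext s
  rw [chaosReversalMap_apply, chaosReversalMap_apply]
  exact sectorReversal_sectorReversal (F s)

/-- **Momentum reversal `Θ` on `𝔉`**: `(Θ Φ)_{m,n}(k; k') = Φ_{n,m}(−k'; −k)`, a unitary involution, to
which the identification carries `Θ [A] = [A ∘ R]` (field `iso_reversal`); on images of real observables it
reads `Φ_{m,n} ↦ conj Φ_{m,n}(−k; −k')`. [folklore] -/
def chaosReversal : ChaosSpace ≃ₗᵢ[ℂ] ChaosSpace :=
  LinearIsometryEquiv.ofSurjective chaosReversalMap fun F =>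
    ⟨chaosReversalMap F, chaosReversalMap_chaosReversalMap F⟩

/-- Components of `Θ`. [folklore] -/
theorem chaosReversal_apply (F : ChaosSpace) (s : SectorIndex) :
    chaosReversal F s = sectorReversal s.cr s.an (F (SectorIndex.swap s)) := rfl

/-- `Θ² = 1`. [folklore] -/
theorem chaosReversal_chaosReversal (F : ChaosSpace) : chaosReversal (chaosReversal F) = F :=
  chaosReversalMap_chaosReversalMap F

/-- **`U⁰_t Θ = Θ U⁰_{−t}`** on `𝔉`. [folklore] -/
theorem chaosKoopman_chaosReversal (ω₂ t : ℝ) (F : ChaosSpace) :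
    chaosKoopman ω₂ t (chaosReversal F) = chaosReversal (chaosKoopman ω₂ (-t) F) := by
  apply lp.ext; funext s
  change sectorKoopman ω₂ s.cr s.an t (sectorReversal s.cr s.an (F (SectorIndex.swap s))) =
    sectorReversal s.cr s.an (sectorKoopman ω₂ s.an s.cr (-t) (F (SectorIndex.swap s)))
  exact sectorKoopman_sectorReversal ω₂ t (F (SectorIndex.swap s))

/-- **The symmetric (bosonic) subspace `𝔉_sym`**: every sector component is symmetric — the range of the
complexified identification (fields `iso_mem_chaosSymmetric`, `exists_eq_iso_add_I_smul`). [cite: Janson1997, Thm 4.1] -/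
def chaosSymmetric : Submodule ℂ ChaosSpace where
  carrier := {F | ∀ s, F s ∈ symmetricSubspace s.cr s.an}
  zero_mem' s := by rw [lp.coeFn_zero, Pi.zero_apply]; exact Submodule.zero_mem _
  add_mem' {F G} hF hG s := by
    rw [lp.coeFn_add, Pi.add_apply]; exact Submodule.add_mem _ (hF s) (hG s)
  smul_mem' c F hF s := by
    rw [lp.coeFn_smul, Pi.smul_apply]; exact Submodule.smul_mem _ c (hF s)

/-- Membership in `𝔉_sym`. [folklore] -/
theorem mem_chaosSymmetric_iff (F : ChaosSpace) :
    F ∈ chaosSymmetric ↔ ∀ s, F s ∈ symmetricSubspace s.cr s.an := Iff.rfl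

/-- `𝔉_sym` is closed. [folklore] -/
theorem isClosed_chaosSymmetric : IsClosed (chaosSymmetric : Set ChaosSpace) := by
  have h : (chaosSymmetric : Set ChaosSpace) =
      ⋂ s : SectorIndex, (fun F : ChaosSpace => F s) ⁻¹' (symmetricSubspace s.cr s.an : Set _) := by
    ext F
    simp [mem_chaosSymmetric_iff]
  rw [h]
  exact isClosed_iInter fun s =>
    (isClosed_symmetricSubspace s.cr s.an).preimage (lp.lipschitzWith_one_eval 2 s).continuous

/-- **The odd projection `P_odd = ½(1 − Θ)`** on `𝔉` (onto the `Θ`-odd sector, home of the current).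
[folklore] -/
def chaosOddProj : ChaosSpace →L[ℂ] ChaosSpace :=
  (2⁻¹ : ℂ) • (ContinuousLinearMap.id ℂ ChaosSpace -
    (chaosReversal.toContinuousLinearEquiv : ChaosSpace →L[ℂ] ChaosSpace))

/-- **The even projection `P_even = ½(1 + Θ)`** on `𝔉`. [folklore] -/
def chaosEvenProj : ChaosSpace →L[ℂ] ChaosSpace :=
  (2⁻¹ : ℂ) • (ContinuousLinearMap.id ℂ ChaosSpace +
    (chaosReversal.toContinuousLinearEquiv : ChaosSpace →L[ℂ] ChaosSpace))

/-- `P_odd Φ = ½(Φ − ΘΦ)`. [folklore] -/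
theorem chaosOddProj_apply (F : ChaosSpace) :
    chaosOddProj F = (2⁻¹ : ℂ) • (F - chaosReversal F) := rfl

/-- `P_even Φ = ½(Φ + ΘΦ)`. [folklore] -/
theorem chaosEvenProj_apply (F : ChaosSpace) :
    chaosEvenProj F = (2⁻¹ : ℂ) • (F + chaosReversal F) := rfl

/-- `P_odd + P_even = 1`. [folklore] -/
theorem chaosOddProj_add_chaosEvenProj (F : ChaosSpace) : chaosOddProj F + chaosEvenProj F = F := by
  rw [chaosOddProj_apply, chaosEvenProj_apply, ← smul_add]
  have h : F - chaosReversal F + (F + chaosReversal F) = (2 : ℂ) • F := by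
    rw [two_smul]; abel
  rw [h, smul_smul, inv_mul_cancel₀ two_ne_zero, one_smul]

/-- `Θ P_odd = −P_odd`. [folklore] -/
theorem chaosReversal_chaosOddProj (F : ChaosSpace) :
    chaosReversal (chaosOddProj F) = -chaosOddProj F := by
  rw [chaosOddProj_apply, LinearIsometryEquiv.map_smul, map_sub, chaosReversal_chaosReversal,
    ← smul_neg, neg_sub]

/-- `Θ P_even = P_even`. [folklore] -/
theorem chaosReversal_chaosEvenProj (F : ChaosSpace) :
    chaosReversal (chaosEvenProj F) = chaosEvenProj F := by
  rw [chaosEvenProj_apply, LinearIsometryEquiv.map_smul, map_add, chaosReversal_chaosReversal,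
    add_comm]

/-- `P_odd² = P_odd`. [folklore] -/
theorem chaosOddProj_chaosOddProj (F : ChaosSpace) :
    chaosOddProj (chaosOddProj F) = chaosOddProj F := by
  have h := chaosOddProj_apply (chaosOddProj F)
  rw [chaosReversal_chaosOddProj, sub_neg_eq_add, ← two_smul ℂ, smul_smul,
    inv_mul_cancel₀ two_ne_zero, one_smul] at h
  exact h

/-- `P_even² = P_even`. [folklore] -/
theorem chaosEvenProj_chaosEvenProj (F : ChaosSpace) :
    chaosEvenProj (chaosEvenProj F) = chaosEvenProj F := by
  have h := chaosEvenProj_apply (chaosEvenProj F)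
  rw [chaosReversal_chaosEvenProj, ← two_smul ℂ, smul_smul, inv_mul_cancel₀ two_ne_zero,
    one_smul] at h
  exact h

/-! ## §4. Wick calculus of the harmonic chain: linear observables, thermal covariance, Wick kernels -/

/-- Coefficient data `(f^q, f^p)` (finitely supported real sequences) of a linear local observable
`φ(f) = Σ_x (f^q_x q_x + f^p_x p_x)`. [folklore] -/
abbrev TestFn : Type := (ℤ →₀ ℝ) × (ℤ →₀ ℝ)

/-- **The linear local observable** `φ(f)(σ) = Σ_x (f^q_x q_x + f^p_x p_x)` on `ChainConfig`. [folklore] -/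
def linObs (f : TestFn) (σ : ChainConfig) : ℝ :=
  (f.1.sum fun x a => a * (σ x).1) + f.2.sum fun x a => a * (σ x).2

/-- **The lattice Green function** of `A = ω₂ − Δ`: `G(x) = ∫_𝕋 cos(kx) ω(k)⁻² dk`
(`= Cov(q_0, q_x)/T` in the harmonic Gibbs state; `e^{ikx} = fourier x k` on `𝕋 = ℝ/2πℤ`). [folklore] -/
def greenFn (ω₂ : ℝ) (x : ℤ) : ℝ := ∫ k, (fourier x k : ℂ).re / dispersion ω₂ k ^ 2 ∂μ𝕋

/-- **The thermal covariance** of two linear observables in the harmonic Gibbs state at temperature `T`: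
`C_T(f, g) = Cov(φ(f), φ(g)) = T (Σ_{x,y} f^q_x g^q_y G(x − y) + Σ_x f^p_x g^p_x)` (positions and momenta
independent, momenta white). [cite: LanfordLebowitzLieb1977, §4 remark (ii)] -/
def thermalCov (ω₂ T : ℝ) (f g : TestFn) : ℝ :=
  T * ((f.1.sum fun x a => g.1.sum fun y b => a * b * greenFn ω₂ (x - y)) +
    f.2.sum fun x a => a * g.2 x)

/-- **The Wick product** `:φ(f_0) ⋯ φ(f_{N-1}):` with respect to the thermal covariance `C_T`, defined by
Janson's recursion `:ξ_0 ξ_1 ⋯ ξ_n: = ξ_0 :ξ_1 ⋯ ξ_n: − Σ_{i ≥ 1} C(ξ_0, ξ_i) :Π_{j ≠ 0, i} ξ_j:`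
(a local polynomial observable). [cite: Janson1997, Thm 3.15] -/
def wick (ω₂ T : ℝ) : (N : ℕ) → (Fin N → TestFn) → ChainConfig → ℝ
  | 0, _ => fun _ => 1
  | 1, f => linObs (f 0)
  | N + 2, f => fun σ =>
      linObs (f 0) σ * wick ω₂ T (N + 1) (Fin.tail f) σ -
        ∑ i : Fin (N + 1), thermalCov ω₂ T (f 0) (f i.succ) *
          wick ω₂ T N (Fin.removeNth i (Fin.tail f)) σ

/-- The empty Wick product is `1`. [folklore] -/
@[simp] theorem wick_zero (ω₂ T : ℝ) (f : Fin 0 → TestFn) : wick ω₂ T 0 f = fun _ => 1 := rfl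

/-- `:φ(f): = φ(f)`. [cite: Janson1997, eq. (3.3)] -/
@[simp] theorem wick_one (ω₂ T : ℝ) (f : Fin 1 → TestFn) : wick ω₂ T 1 f = linObs (f 0) := rfl

/-- `:φ(f) φ(g): = φ(f) φ(g) − C_T(f, g)`. [cite: Janson1997, eq. (3.4)] -/
theorem wick_two (ω₂ T : ℝ) (f : Fin 2 → TestFn) (σ : ChainConfig) :
    wick ω₂ T 2 f σ = linObs (f 0) σ * linObs (f 1) σ - thermalCov ω₂ T (f 0) (f 1) := by
  simp [wick, Fin.tail]

/-- **The Rayleigh–Jeans weight** `W(k) = T/ω(k)`, the one-phonon two-point function of the harmonic Gibbs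
state (`E[ā(k) a(k')] = W(k) δ(k − k')`, `E[a a] = 0`; the equilibrium Wigner function of ALS06 at
`τ = 0`, `β = 1/T`). [cite: AokiLukkarinenSpohn2006, eqs. (3.11)–(3.12)] -/
def thermalWeight (ω₂ T : ℝ) (k : 𝕋) : ℝ := T / dispersion ω₂ k

/-- **The thermal one-phonon wave function** of `φ(f)`: `w_f(k) = √(T/2) Σ_x e^{ikx} (f^q_x/ω(k) − i f^p_x)`
(`= √W(k) ·` the coefficient of the annihilation field `a(k)` in `φ(f) = ∫ (ū_f ā + u_f a) dk`,
`u_f = w_f/√W`), so that `Cov(φ(f), φ(g) ∘ τ_y) = 2 Re ∫ w̄_f w_g e^{iky} dk`. [folklore] -/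
def thermalWave (ω₂ T : ℝ) (f : TestFn) (k : 𝕋) : ℂ :=
  (Real.sqrt (T / 2) : ℂ) *
    ((f.1.sum fun x a => (a : ℂ) * fourier x k / (dispersion ω₂ k : ℂ)) -
      Complex.I * f.2.sum fun x a => (a : ℂ) * fourier x k)

/-- `w_f` is continuous for `ω₂ > 0`. [folklore] -/
theorem continuous_thermalWave {ω₂ : ℝ} (hω : 0 < ω₂) (T : ℝ) (f : TestFn) :
    Continuous (thermalWave ω₂ T f) := by
  unfold thermalWave
  refine continuous_const.mul (Continuous.sub ?_ (continuous_const.mul ?_))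
  · refine continuous_finsetSum _ fun x _ => ?_
    exact (continuous_const.mul (fourier x).continuous).div
      (Complex.continuous_ofReal.comp (continuous_dispersion ω₂))
      (fun k => Complex.ofReal_ne_zero.2 (dispersion_ne_zero hω k))
  · exact continuous_finsetSum _ fun x _ => continuous_const.mul (fourier x).continuous

/-- The **flat-normalisation weight** `√(m! n!) Π_i √W(k_i) Π_j √W(k'_j)` converting a physical kernel
`F_{m,n}` (coefficient of `:Π ā(k_i) Π a(k'_j):`) into its chaos-space representative
`Φ_{m,n} = kernelWeight · F_{m,n}` (Wick's theorem: `‖:∫F Πā Πa:‖² = m! n! ∫ |F|² ΠW`).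
[cite: Janson1997, Thm 3.9] -/
def kernelWeight (ω₂ T : ℝ) {m n : ℕ} (κ : Shell m n) : ℝ :=
  Real.sqrt (m.factorial * n.factorial) *
    ((∏ i, Real.sqrt (thermalWeight ω₂ T ((κ : SectorConfig m n).1 i))) *
      ∏ j, Real.sqrt (thermalWeight ω₂ T ((κ : SectorConfig m n).2 j)))

/-- **The Wick kernel** of `:φ(f_0) ⋯ φ(f_{N-1}):` in the sector `(m, n)`, restricted to the zero-momentum
shell, flat normalisation:
`Φ_{m,n}(k; k') = (m! n!)^{-1/2} Σ_{β : Fin m ⊕ Fin n ≃ Fin N} Π_i w̄_{f_{β(inl i)}}(k_i) Π_j w_{f_{β(inr j)}}(k'_j)`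
(the sum over bijections is the symmetrised sum over the ways of assigning `m` of the `N` factors to creation
and `n` to annihilation; empty unless `m + n = N`). [cite: Janson1997, Thms 3.9 and 4.1] -/
def wickKernel (ω₂ T : ℝ) {N : ℕ} (f : Fin N → TestFn) (m n : ℕ) (κ : Shell m n) : ℂ :=
  ((Real.sqrt (m.factorial * n.factorial) : ℝ) : ℂ)⁻¹ *
    ∑ β : (Fin m ⊕ Fin n) ≃ Fin N,
      (∏ i, conj (thermalWave ω₂ T (f (β (Sum.inl i))) ((κ : SectorConfig m n).1 i))) *
        ∏ j, thermalWave ω₂ T (f (β (Sum.inr j))) ((κ : SectorConfig m n).2 j)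

/-- The Wick kernel of a monomial of degree `N` vanishes in the sectors with `m + n ≠ N`. [folklore] -/
theorem wickKernel_of_ne (ω₂ T : ℝ) {N : ℕ} (f : Fin N → TestFn) {m n : ℕ} (h : m + n ≠ N) :
    wickKernel ω₂ T f m n = 0 := by
  have hE : IsEmpty ((Fin m ⊕ Fin n) ≃ Fin N) := by
    refine ⟨fun β => h ?_⟩
    have := Fintype.card_congr β
    simpa using this
  funext κ
  simp only [wickKernel, Finset.univ_eq_empty, Finset.sum_empty, mul_zero, Pi.zero_apply]

/-- The Wick kernels are continuous for `ω₂ > 0`. [folklore] -/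
theorem continuous_wickKernel {ω₂ : ℝ} (hω : 0 < ω₂) (T : ℝ) {N : ℕ} (f : Fin N → TestFn) (m n : ℕ) :
    Continuous (wickKernel ω₂ T f m n) := by
  unfold wickKernel
  refine continuous_const.mul (continuous_finsetSum _ fun β _ => Continuous.mul ?_ ?_)
  · refine continuous_finsetProd _ fun i _ => ?_
    exact (Complex.continuous_conj.comp (continuous_thermalWave hω T _)).comp
      ((continuous_apply i).comp (continuous_fst.comp continuous_subtype_val))
  · refine continuous_finsetProd _ fun j _ => ?_
    exact (continuous_thermalWave hω T _).comp
      ((continuous_apply j).comp (continuous_snd.comp continuous_subtype_val))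

/-- **The Wick kernels are symmetric** under relabelling of the momenta (bosonic). [folklore] -/
theorem wickKernel_shellPerm (ω₂ T : ℝ) {N : ℕ} (f : Fin N → TestFn) {m n : ℕ}
    (σ : Equiv.Perm (Fin m)) (τ : Equiv.Perm (Fin n)) (κ : Shell m n) :
    wickKernel ω₂ T f m n (shellPerm σ τ κ) = wickKernel ω₂ T f m n κ := by
  unfold wickKernel
  congr 1
  refine Fintype.sum_equiv (Equiv.equivCongr (Equiv.sumCongr σ τ) (Equiv.refl (Fin N))) _ _ fun β => ?_
  simp only [Equiv.equivCongr_apply_apply, Equiv.coe_refl, id_eq, shellPerm_apply_fst, shellPerm_apply_snd]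
  congr 1
  · symm
    rw [← Equiv.prod_comp σ]
    refine Finset.prod_congr rfl fun i _ => ?_
    simp
  · symm
    rw [← Equiv.prod_comp τ]
    refine Finset.prod_congr rfl fun j _ => ?_
    simp

/-- The sector labels with `m + n = N` form a finite set. [folklore] -/
theorem finite_sectorIndex_sum (N : ℕ) : Set.Finite {s : SectorIndex | s.cr + s.an = N} := by
  have h : {s : SectorIndex | s.cr + s.an = N} ⊆
      Subtype.val ⁻¹' (↑(Finset.range (N + 1) ×ˢ Finset.range (N + 1)) : Set (ℕ × ℕ)) := by
    intro s hs
    change s.1.1 + s.1.2 = N at hs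
    simp only [Set.mem_preimage, Finset.coe_product, Finset.coe_range, Set.mem_prod, Set.mem_Iio]
    constructor <;> omega
  exact Set.Finite.subset ((Finset.finite_toSet _).preimage Subtype.val_injective.injOn) h

/-- **The chaos vector** `ι[:φ(f_0) ⋯ φ(f_{N-1}):] ∈ 𝔉` of a Wick monomial: sector by sector the `L²`
class of `wickKernel` (finitely many non-zero sectors, those with `m + n = N`) — the right-hand side of the
field `iso_fluct_wick` pinning the identification on a dense set. [cite: Janson1997, Thm 4.1] -/
def wickVector (ω₂ T : ℝ) {N : ℕ} (f : Fin N → TestFn) : ChaosSpace :=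
  ⟨fun s => toL2C (shellMeasure s.cr s.an) (wickKernel ω₂ T f s.cr s.an), by
    refine (memℓp_zero ?_).of_exponent_ge zero_le
    refine (finite_sectorIndex_sum N).subset ?_
    intro s hs
    simp only [Set.mem_setOf_eq] at hs ⊢
    by_contra hne
    exact hs (by rw [wickKernel_of_ne ω₂ T f hne, toL2C_zero])⟩

/-- Components of `wickVector`. [folklore] -/
theorem wickVector_apply (ω₂ T : ℝ) {N : ℕ} (f : Fin N → TestFn) (s : SectorIndex) :
    wickVector ω₂ T f s = toL2C (shellMeasure s.cr s.an) (wickKernel ω₂ T f s.cr s.an) := rfl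

/-- For `ω₂ > 0` the components of `wickVector` are represented by the (continuous) Wick kernels. [folklore] -/
theorem coeFn_wickVector {ω₂ : ℝ} (hω : 0 < ω₂) (T : ℝ) {N : ℕ} (f : Fin N → TestFn) (s : SectorIndex) :
    (wickVector ω₂ T f s : Shell s.cr s.an → ℂ) =ᵐ[shellMeasure s.cr s.an] wickKernel ω₂ T f s.cr s.an :=
  coeFn_toL2C (memLp_two_of_continuous_shell (continuous_wickKernel hω T f s.cr s.an))

/-- Wick vectors are bosonic: `wickVector f ∈ 𝔉_sym` (`ω₂ > 0`). [folklore] -/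
theorem wickVector_mem_chaosSymmetric {ω₂ : ℝ} (hω : 0 < ω₂) (T : ℝ) {N : ℕ} (f : Fin N → TestFn) :
    wickVector ω₂ T f ∈ chaosSymmetric := by
  intro s σ τ
  apply Lp.ext
  have hq := (measurePreserving_shellPerm σ τ).quasiMeasurePreserving
  filter_upwards [coeFn_sectorPerm σ τ (wickVector ω₂ T f s), coeFn_wickVector hω T f s,
    hq.ae_eq (coeFn_wickVector hω T f s)] with κ h1 h2 h3
  rw [h1]
  simp only [Function.comp_apply] at h3
  rw [h3, wickKernel_shellPerm, h2]

/-! ## §5. The one-phonon-charge sector `(1, 1) ≅ L²(𝕋, dk)` -/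

/-- The diagonal parametrisation `k ↦ (k; k)` of the shell of the sector `(1, 1)` (a continuous group
isomorphism `𝕋 ≃+ Shell 1 1`). [folklore] -/
def diagShell : 𝕋 ≃+ Shell 1 1 where
  toFun k := ⟨(fun _ => k, fun _ => k), by rw [mem_shell_iff]; simp⟩
  invFun κ := (κ : SectorConfig 1 1).1 0
  left_inv k := rfl
  right_inv κ := by
    have h := (mem_shell_iff (κ : SectorConfig 1 1)).1 κ.2
    simp only [Fin.sum_univ_one, sub_eq_zero] at h
    apply Subtype.ext
    refine Prod.ext (funext fun i => ?_) (funext fun j => ?_)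
    · rw [Fin.eq_zero i]
    · rw [Fin.eq_zero j]; exact h
  map_add' _ _ := Subtype.ext rfl

/-- `diagShell⁻¹ (k; k') = k`. [folklore] -/
theorem diagShell_symm_apply (κ : Shell 1 1) : diagShell.symm κ = (κ : SectorConfig 1 1).1 0 := rfl

/-- On the shell of `(1, 1)`, `k' = k`. [folklore] -/
theorem shell_one_one_snd (κ : Shell 1 1) : (κ : SectorConfig 1 1).2 0 = (κ : SectorConfig 1 1).1 0 := by
  have h := (mem_shell_iff (κ : SectorConfig 1 1)).1 κ.2
  simp only [Fin.sum_univ_one, sub_eq_zero] at h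
  exact h.symm

/-- `diagShell` is continuous. [folklore] -/
theorem continuous_diagShell : Continuous diagShell :=
  Continuous.subtype_mk ((continuous_pi fun _ => continuous_id).prodMk
    (continuous_pi fun _ => continuous_id)) _

/-- `diagShell⁻¹` is continuous. [folklore] -/
theorem continuous_diagShell_symm : Continuous diagShell.symm :=
  (continuous_apply 0).comp (continuous_fst.comp continuous_subtype_val)

/-- `diagShell` carries `dk` to `σ_{1,1}`. [folklore] -/
theorem measurePreserving_diagShell : MeasurePreserving diagShell μ𝕋 (shellMeasure 1 1) :=
  measurePreserving_addEquiv _ _ _ continuous_diagShell continuous_diagShell_symm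

/-- `diagShell⁻¹` carries `σ_{1,1}` to `dk`. [folklore] -/
theorem measurePreserving_diagShell_symm :
    MeasurePreserving diagShell.symm (shellMeasure 1 1) μ𝕋 :=
  measurePreserving_addEquiv _ _ diagShell.symm continuous_diagShell_symm continuous_diagShell

/-- **The free frequency vanishes identically on the one-phonon-charge shell** `k = k'`: the sector `(1,1)`
lies in the kernel of the free generator — the infinitely degenerate embedded eigenvalue `0`. [cite: vanHemmen1980, §4] -/
theorem sectorPhase_one_one (ω₂ : ℝ) (κ : Shell 1 1) : sectorPhase ω₂ κ = 0 := by
  simp only [sectorPhase, Fin.sum_univ_one, shell_one_one_snd, sub_self]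

/-- `U⁰_t = 1` on the sector `(1, 1)`. [folklore] -/
theorem sectorKoopman_one_one (ω₂ t : ℝ) (F : SectorSpace 1 1) : sectorKoopman ω₂ 1 1 t F = F := by
  apply Lp.ext
  filter_upwards [coeFn_sectorKoopman ω₂ t F] with κ hκ
  rw [hκ, sectorPhase_one_one, mul_zero, Complex.ofReal_zero, zero_mul, Complex.exp_zero, one_mul]

/-- The pull-back `g ↦ ((k; k) ↦ g(k))`, `L²(𝕋) → L²(Shell 1 1)`, a linear isometry. [folklore] -/
def onePhononMap : Lp ℂ 2 μ𝕋 →ₗᵢ[ℂ] SectorSpace 1 1 :=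
  Lp.compMeasurePreservingₗᵢ ℂ diagShell.symm measurePreserving_diagShell_symm

/-- **The one-phonon-charge sector is `L²(𝕋, dk)`**: the unitary `L²(𝕋) ≃ L²(Shell 1 1)`,
`g ↦ ((k; k) ↦ g(k))` (a profile `g` is the class of the density of `∫ (g/W)(k)|a(k)|² dk`; in the weighted
picture `L²(𝕋, W² dk) ∋ g/W`). [cite: vanHemmen1980, §3] -/
def onePhonon : Lp ℂ 2 μ𝕋 ≃ₗᵢ[ℂ] SectorSpace 1 1 :=
  LinearIsometryEquiv.ofSurjective onePhononMap fun G =>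
    ⟨Lp.compMeasurePreserving diagShell measurePreserving_diagShell G, by
      change Lp.compMeasurePreserving diagShell.symm measurePreserving_diagShell_symm
        (Lp.compMeasurePreserving diagShell measurePreserving_diagShell G) = G
      rw [← Lp.compMeasurePreserving_comp_apply G measurePreserving_diagShell
        measurePreserving_diagShell_symm]
      have h : (diagShell : 𝕋 → Shell 1 1) ∘ diagShell.symm = id := diagShell.self_comp_symm
      simp only [h]
      exact Lp.compMeasurePreserving_id_apply G⟩

/-- `onePhonon g (k; k') = g(k)` a.e. [folklore] -/
theorem coeFn_onePhonon (g : Lp ℂ 2 μ𝕋) :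
    onePhonon g =ᵐ[shellMeasure 1 1] fun κ => g ((κ : SectorConfig 1 1).1 0) :=
  Lp.coeFn_compMeasurePreserving g measurePreserving_diagShell_symm

/-- A one-phonon-charge profile `g : 𝕋 → ℂ` as a vector of `𝔉` supported in the sector `(1, 1)` (junk `0`
if `g ∉ L²`). [folklore] -/
def onePhononVector (g : 𝕋 → ℂ) : ChaosSpace :=
  lp.single 2 SectorIndex.oneOne (onePhonon (toL2C μ𝕋 g))

/-- The `(1,1)` component of `onePhononVector g`. [folklore] -/
theorem onePhononVector_apply_oneOne (g : 𝕋 → ℂ) :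
    onePhononVector g SectorIndex.oneOne = onePhonon (toL2C μ𝕋 g) :=
  lp.single_apply_self _ _ _

/-- The other components of `onePhononVector g` vanish. [folklore] -/
theorem onePhononVector_apply_ne (g : 𝕋 → ℂ) {s : SectorIndex} (hs : s ≠ SectorIndex.oneOne) :
    onePhononVector g s = 0 :=
  lp.single_apply_ne _ _ _ hs

/-- `‖onePhononVector g‖ = ‖g‖_{L²(𝕋)}`. [folklore] -/
theorem norm_onePhononVector (g : 𝕋 → ℂ) : ‖onePhononVector g‖ = ‖toL2C μ𝕋 g‖ := by
  rw [onePhononVector, lp.norm_single two_pos]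
  exact onePhonon.norm_map _

/-- `onePhononVector (−g) = −onePhononVector g` for `g ∈ L²`. [folklore] -/
theorem onePhononVector_neg {g : 𝕋 → ℂ} (hg : MemLp g 2 μ𝕋) :
    onePhononVector (fun k => -g k) = -onePhononVector g := by
  rw [onePhononVector, onePhononVector, toL2C_neg hg, map_neg]
  exact lp.single_neg (E := SectorFamily) 2 SectorIndex.oneOne (onePhonon (toL2C μ𝕋 g))

/-- **The one-phonon charges are conserved by the free dynamics**: `U⁰_t` fixes every `onePhononVector`
(they span the degenerate eigenvalue `0`). [cite: vanHemmen1980, §4] -/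
theorem chaosKoopman_onePhononVector (ω₂ t : ℝ) (g : 𝕋 → ℂ) :
    chaosKoopman ω₂ t (onePhononVector g) = onePhononVector g := by
  apply lp.ext; funext s
  rw [chaosKoopman_apply]
  by_cases hs : s = SectorIndex.oneOne
  · subst hs
    exact sectorKoopman_one_one ω₂ t _
  · rw [onePhononVector_apply_ne g hs, map_zero]

/-- **`Θ` acts on the one-phonon-charge sector by `g ↦ g(−·)`** (`g ∈ L²`). [folklore] -/
theorem chaosReversal_onePhononVector {g : 𝕋 → ℂ} (hg : MemLp g 2 μ𝕋) :
    chaosReversal (onePhononVector g) = onePhononVector fun k => g (-k) := by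
  have hg' : MemLp (fun k => g (-k)) 2 μ𝕋 := hg.comp_measurePreserving measurePreserving_neg_circle
  apply lp.ext; funext s
  rw [chaosReversal_apply]
  by_cases hs : s = SectorIndex.oneOne
  · subst hs
    change sectorReversal 1 1 (onePhononVector g SectorIndex.oneOne) =
      onePhononVector (fun k => g (-k)) SectorIndex.oneOne
    rw [onePhononVector_apply_oneOne, onePhononVector_apply_oneOne]
    apply Lp.ext
    have hflip := (measurePreserving_shellFlip 1 1).quasiMeasurePreserving
    have hproj := measurePreserving_diagShell_symm.quasiMeasurePreserving
    have hnegproj :=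
      (measurePreserving_neg_circle.comp measurePreserving_diagShell_symm).quasiMeasurePreserving
    filter_upwards [coeFn_sectorReversal (m := 1) (n := 1) (onePhonon (toL2C μ𝕋 g)),
      hflip.ae_eq (coeFn_onePhonon (toL2C μ𝕋 g)),
      coeFn_onePhonon (toL2C μ𝕋 fun k => g (-k)),
      hproj.ae_eq (coeFn_toL2C hg'), hnegproj.ae_eq (coeFn_toL2C hg)] with κ h1 h2 h3 h4 h5
    rw [h1]
    simp only [Function.comp_apply] at h2 h4 h5
    rw [h2, shellFlip_apply_fst, shell_one_one_snd, h3]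
    rw [diagShell_symm_apply] at h4 h5
    rw [h4, h5]
  · have hs' : SectorIndex.swap s ≠ SectorIndex.oneOne := by
      intro h
      apply hs
      rw [← SectorIndex.swap_swap s, h, SectorIndex.swap_oneOne]
    rw [onePhononVector_apply_ne _ hs', onePhononVector_apply_ne _ hs]
    exact map_zero (sectorReversal s.cr s.an)

/-- **The `(1,1)` profile of the energy current** `[J] = [j_0]`: `T ω'(k) = T sin k/ω(k)` (flat
normalisation: `2 Re(w̄_f w_g)` for `j_0 = φ(f) φ(g)`, `f^p = −½(δ_0 + δ_1)`, `g^q = δ_1 − δ_0`; physical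
kernel `g_J = ω ω' = sin k`, ALS06 (3.9): `J = ∫ ω ω' a*a dk`). [cite: AokiLukkarinenSpohn2006, eq. (3.9)] -/
def currentProfile (ω₂ T : ℝ) (k : 𝕋) : ℂ := ((T * currentWeight ω₂ k : ℝ) : ℂ)

/-- **The `(1,1)` profile of the energy density** `[h] = [h_0]`: the constant `T` (physical kernel
`g_h = ω`: `H_har = ∫ ω a*a dk`, ALS06 (3.8)). [cite: AokiLukkarinenSpohn2006, eq. (3.8)] -/
def energyProfile (T : ℝ) (_k : 𝕋) : ℂ := (T : ℂ)

/-- `k ↦ T ω'(k)` is continuous for `ω₂ > 0`. [folklore] -/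
theorem continuous_currentProfile {ω₂ : ℝ} (hω : 0 < ω₂) (T : ℝ) :
    Continuous (currentProfile ω₂ T) :=
  Complex.continuous_ofReal.comp (continuous_const.mul (continuous_currentWeight hω))

/-- The current profile is odd. [folklore] -/
theorem currentProfile_neg (ω₂ T : ℝ) (k : 𝕋) :
    currentProfile ω₂ T (-k) = -currentProfile ω₂ T k := by
  simp [currentProfile, currentWeight_neg]

/-- **The chaos vector of the current class** `ι[J]` (field `iso_currentClass`). [folklore] -/
def currentVector (ω₂ T : ℝ) : ChaosSpace := onePhononVector (currentProfile ω₂ T)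

/-- **The chaos vector of the energy class** `ι[h]` (field `iso_energyClass`). [folklore] -/
def energyVector (T : ℝ) : ChaosSpace := onePhononVector (energyProfile T)

/-- **The current is odd**: `Θ ι[J] = −ι[J]` (`ω₂ > 0`). [folklore] -/
theorem chaosReversal_currentVector {ω₂ : ℝ} (hω : 0 < ω₂) (T : ℝ) :
    chaosReversal (currentVector ω₂ T) = -currentVector ω₂ T := by
  have hg := memLp_two_of_continuous_circle (continuous_currentProfile hω T)
  rw [currentVector, chaosReversal_onePhononVector hg]
  simp only [currentProfile_neg]
  exact onePhononVector_neg hg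

/-- **The energy is even**: `Θ ι[h] = ι[h]`. [folklore] -/
theorem chaosReversal_energyVector (T : ℝ) : chaosReversal (energyVector T) = energyVector T := by
  rw [energyVector, chaosReversal_onePhononVector (g := energyProfile T) (memLp_const _)]
  rfl

/-- `P_odd ι[J] = ι[J]`. [folklore] -/
theorem chaosOddProj_currentVector {ω₂ : ℝ} (hω : 0 < ω₂) (T : ℝ) :
    chaosOddProj (currentVector ω₂ T) = currentVector ω₂ T := by
  rw [chaosOddProj_apply, chaosReversal_currentVector hω, sub_neg_eq_add, ← two_smul ℂ,
    smul_smul, inv_mul_cancel₀ two_ne_zero, one_smul]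

/-- `P_even ι[J] = 0`. [folklore] -/
theorem chaosEvenProj_currentVector {ω₂ : ℝ} (hω : 0 < ω₂) (T : ℝ) :
    chaosEvenProj (currentVector ω₂ T) = 0 := by
  rw [chaosEvenProj_apply, chaosReversal_currentVector hω, add_neg_cancel, smul_zero]

/-- `P_odd ι[h] = 0`. [folklore] -/
theorem chaosOddProj_energyVector (T : ℝ) : chaosOddProj (energyVector T) = 0 := by
  rw [chaosOddProj_apply, chaosReversal_energyVector, sub_self, smul_zero]

/-- `P_even ι[h] = ι[h]`. [folklore] -/
theorem chaosEvenProj_energyVector (T : ℝ) : chaosEvenProj (energyVector T) = energyVector T := by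
  rw [chaosEvenProj_apply, chaosReversal_energyVector, ← two_smul ℂ, smul_smul,
    inv_mul_cancel₀ two_ne_zero, one_smul]

/-- `U⁰_t ι[J] = ι[J]`. [folklore] -/
theorem chaosKoopman_currentVector (ω₂ t T : ℝ) :
    chaosKoopman ω₂ t (currentVector ω₂ T) = currentVector ω₂ T :=
  chaosKoopman_onePhononVector ω₂ t _

/-- `U⁰_t ι[h] = ι[h]`. [folklore] -/
theorem chaosKoopman_energyVector (ω₂ t T : ℝ) :
    chaosKoopman ω₂ t (energyVector T) = energyVector T :=
  chaosKoopman_onePhononVector ω₂ t _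

/-! ## §6. The explicit harmonic propagator; parity on `ℋ₀` -/

/-- `C_t(x) = ∫ cos(ω(k) t) cos(kx) dk`, the kernel of `cos(√A t)`, `A = ω₂ − Δ` (symbol `ω(k)²`). [cite: LanfordLebowitz1975] -/
def propCos (ω₂ t : ℝ) (x : ℤ) : ℝ := ∫ k, Real.cos (dispersion ω₂ k * t) * (fourier x k : ℂ).re ∂μ𝕋

/-- `S_t(x) = ∫ sin(ω(k) t) ω(k)⁻¹ cos(kx) dk`, the kernel of `A^{-1/2} sin(√A t)`. [cite: LanfordLebowitz1975] -/
def propSin (ω₂ t : ℝ) (x : ℤ) : ℝ :=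
  ∫ k, Real.sin (dispersion ω₂ k * t) / dispersion ω₂ k * (fourier x k : ℂ).re ∂μ𝕋

/-- `Ċ_t(x) = −∫ ω(k) sin(ω(k) t) cos(kx) dk`, the kernel of `−√A sin(√A t)`. [cite: LanfordLebowitz1975] -/
def propCosDeriv (ω₂ t : ℝ) (x : ℤ) : ℝ :=
  -∫ k, dispersion ω₂ k * Real.sin (dispersion ω₂ k * t) * (fourier x k : ℂ).re ∂μ𝕋

end HarmonicChaos

namespace ZeroWavenumberData

variable {P : OscillatorChain} {D : InfiniteChainDynamics P} (Z : ZeroWavenumberData P D)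

/-- **`P_odd = ½(1 − Θ)` on `ℋ₀`**: the projection onto the momentum-reversal-odd sector `{Θψ = −ψ}` of the
zero-wavenumber space of any chain data with `HasMomentumReversal` (the sector carrying the current, on
which the requested Mourre estimate is stated). [folklore] -/
def oddProj (h : Z.HasMomentumReversal) : ZeroWavenumberSpace Z →L[ℝ] ZeroWavenumberSpace Z :=
  (2⁻¹ : ℝ) • (ContinuousLinearMap.id ℝ (ZeroWavenumberSpace Z) - Z.reversal h)

/-- **`P_even = ½(1 + Θ)` on `ℋ₀`**. [folklore] -/
def evenProj (h : Z.HasMomentumReversal) : ZeroWavenumberSpace Z →L[ℝ] ZeroWavenumberSpace Z :=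
  (2⁻¹ : ℝ) • (ContinuousLinearMap.id ℝ (ZeroWavenumberSpace Z) + Z.reversal h)

/-- `P_odd ψ = ½(ψ − Θψ)`. [folklore] -/
theorem oddProj_apply (h : Z.HasMomentumReversal) (ψ : ZeroWavenumberSpace Z) :
    Z.oddProj h ψ = (2⁻¹ : ℝ) • (ψ - Z.reversal h ψ) := rfl

/-- `P_even ψ = ½(ψ + Θψ)`. [folklore] -/
theorem evenProj_apply (h : Z.HasMomentumReversal) (ψ : ZeroWavenumberSpace Z) :
    Z.evenProj h ψ = (2⁻¹ : ℝ) • (ψ + Z.reversal h ψ) := rfl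

/-- `P_odd + P_even = 1`. [folklore] -/
theorem oddProj_add_evenProj (h : Z.HasMomentumReversal) (ψ : ZeroWavenumberSpace Z) :
    Z.oddProj h ψ + Z.evenProj h ψ = ψ := by
  rw [oddProj_apply, evenProj_apply, ← smul_add]
  have e : ψ - Z.reversal h ψ + (ψ + Z.reversal h ψ) = (2 : ℝ) • ψ := by rw [two_smul]; abel
  rw [e, smul_smul, inv_mul_cancel₀ two_ne_zero, one_smul]

/-- `Θ P_odd = −P_odd`. [folklore] -/
theorem reversal_oddProj (h : Z.HasMomentumReversal) (ψ : ZeroWavenumberSpace Z) :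
    Z.reversal h (Z.oddProj h ψ) = -Z.oddProj h ψ := by
  rw [oddProj_apply, ContinuousLinearMap.map_smul, map_sub, Z.reversal_reversal h, ← smul_neg,
    neg_sub]

/-- `Θ P_even = P_even`. [folklore] -/
theorem reversal_evenProj (h : Z.HasMomentumReversal) (ψ : ZeroWavenumberSpace Z) :
    Z.reversal h (Z.evenProj h ψ) = Z.evenProj h ψ := by
  rw [evenProj_apply, ContinuousLinearMap.map_smul, map_add, Z.reversal_reversal h, add_comm]

/-- **`P_odd [J] = [J]`**: the current class is odd. [folklore] -/
theorem oddProj_currentClass (h : Z.HasMomentumReversal) : Z.oddProj h Z.currentClass = Z.currentClass := by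
  rw [oddProj_apply, Z.reversal_currentClass h, sub_neg_eq_add, ← two_smul ℝ, smul_smul,
    inv_mul_cancel₀ two_ne_zero, one_smul]

/-- `P_odd [h] = 0`: the energy class is even. [folklore] -/
theorem oddProj_energyClass (h : Z.HasMomentumReversal) : Z.oddProj h Z.energyClass = 0 := by
  rw [oddProj_apply, Z.reversal_energyClass h, sub_self, smul_zero]

/-- `P_even [h] = [h]`. [folklore] -/
theorem evenProj_energyClass (h : Z.HasMomentumReversal) : Z.evenProj h Z.energyClass = Z.energyClass := by
  rw [evenProj_apply, Z.reversal_energyClass h, ← two_smul ℝ, smul_smul, inv_mul_cancel₀ two_ne_zero,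
    one_smul]

/-- `P_even [J] = 0`. [folklore] -/
theorem evenProj_currentClass (h : Z.HasMomentumReversal) : Z.evenProj h Z.currentClass = 0 := by
  rw [evenProj_apply, Z.reversal_currentClass h, add_neg_cancel, smul_zero]

end ZeroWavenumberData

/-! ## §7. The hypothesis structure `HarmonicChaosDecomposition` -/

open HarmonicChaos in
/-- **The harmonic chaos decomposition at temperature `T`** (hypothesis structure; van Hemmen 1980 §§3–4 and
Lanford–Lebowitz 1975 transcribed to Doyon's zero-wavenumber space `ℋ₀`). DATA: an infinite-volume dynamics
`D` of the pinned harmonic chain `pinnedChain ω₂ 0 0 γ` and zero-wavenumber data `Z` over it (state `μ₀`,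
flow-stable local observables with summable clustering; `ZeroWavenumberSpace.lean`), and a real-linear
isometry `iso : ℋ₀(μ₀) → 𝔉`. PROPERTIES: (a) `μ₀` is the translation-invariant Gibbs (DLR) state at
temperature `T` (`gibbs`; shift invariance is part of `Z`), the centred Gaussian with covariance `C_T`
(`charFun_linObs`); the carrier of `D` is shift and momentum-reversal invariant and the flow is the explicit
harmonic flow `q_x(t) = Σ_y (C_t(x−y) q_y + S_t(x−y) p_y)`, `p_x(t) = Σ_y (Ċ_t(x−y) q_y + C_t(x−y) p_y)`
(`hasSum_flow_fst/snd`), reversal is a symmetry and the Koopman group is strongly continuous; Wick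
polynomials of linear observables are local observables (`wick_mem`); (b) THE IDENTIFICATION: `iso` maps
the class of every Wick monomial to its Wick kernels on the zero-momentum shells (`iso_fluct_wick` — this
pins `iso`, the classes being dense; the isometry property is Wick's theorem, Janson Thm 3.9),
intertwines `U_t` with the free second-quantised group `exp(itΩ)` (`iso_koopman`) and `Θ` with the sector
flip (`iso_reversal`), has real complex inner products on its range (`im_inner_iso`) and complexifies to a
unitary onto the bosonic subspace (`iso_mem_chaosSymmetric`, `exists_eq_iso_add_I_smul`); (c) the images
of the current and energy classes are the `(1,1)`-vectors with profiles `T ω'` and `T` (`iso_currentClass`,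
`iso_energyClass`; consequences of (b), see the module docstring). Any instance is meant with `ω₂ > 0`,
`T > 0`. [cite: vanHemmen1980, §§3–4] -/
structure HarmonicChaosDecomposition (ω₂ γ T : ℝ) where
  /-- the infinite-volume harmonic flow on its (tempered) carrier -/
  D : InfiniteChainDynamics (pinnedChain ω₂ 0 0 γ)
  /-- the zero-wavenumber data: the state `μ₀`, local observables, clustering, stationarity, homogeneity -/
  Z : ZeroWavenumberData (pinnedChain ω₂ 0 0 γ) D
  /-- `μ₀` is a Gibbs (DLR) state of the harmonic chain at temperature `T` -/
  gibbs : (pinnedChain ω₂ 0 0 γ).IsChainGibbsMeasure T Z.μ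
  /-- `μ₀` is the centred Gaussian measure with covariance `C_T`: `E e^{iφ(f)} = e^{−C_T(f,f)/2}` -/
  charFun_linObs : ∀ f : TestFn,
    ∫ σ, Complex.exp (Complex.I * (linObs f σ : ℂ)) ∂Z.μ =
      Complex.exp (-((thermalCov ω₂ T f f / 2 : ℝ) : ℂ))
  /-- the carrier is invariant under the lattice shifts -/
  carrier_shift : ∀ x : ℤ, MapsTo (chainShift x) D.carrier D.carrier
  /-- the carrier is invariant under momentum reversal -/
  carrier_reversal : MapsTo chainReversal D.carrier D.carrier
  /-- the flow is the explicit harmonic flow (positions), the series converging on the carrier -/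
  hasSum_flow_fst : ∀ σ ∈ D.carrier, ∀ (t : ℝ) (x : ℤ),
    HasSum (fun y : ℤ => propCos ω₂ t (x - y) * (σ y).1 + propSin ω₂ t (x - y) * (σ y).2)
      ((D.flow t σ x).1)
  /-- the flow is the explicit harmonic flow (momenta) -/
  hasSum_flow_snd : ∀ σ ∈ D.carrier, ∀ (t : ℝ) (x : ℤ),
    HasSum (fun y : ℤ => propCosDeriv ω₂ t (x - y) * (σ y).1 + propCos ω₂ t (x - y) * (σ y).2)
      ((D.flow t σ x).2)
  /-- momentum reversal is a symmetry of the data (`R_* μ₀ = μ₀`, `R ∘ φ_t = φ_{-t} ∘ R` a.e., …) -/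
  hasMomentumReversal : Z.HasMomentumReversal
  /-- the Koopman group `U_t` on `ℋ₀` is strongly continuous -/
  isStronglyContinuous : Z.toFluctuationDynamics.IsStronglyContinuous
  /-- Wick polynomials of linear observables are local observables -/
  wick_mem : ∀ (N : ℕ) (f : Fin N → TestFn), wick ω₂ T N f ∈ Z.localObs
  /-- the identification `ι : ℋ₀ → 𝔉`, a real-linear isometry -/
  iso : ZeroWavenumberSpace Z →ₗᵢ[ℝ] ChaosSpace
  /-- `ι[:φ(f_0)⋯φ(f_{N-1}):]` is the family of Wick kernels on the zero-momentum shells -/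
  iso_fluct_wick : ∀ (N : ℕ) (f : Fin N → TestFn), iso (Z.fluct (wick ω₂ T N f)) = wickVector ω₂ T f
  /-- `ι U_t = U⁰_t ι`: the Koopman group is carried to multiplication by `exp(itΩ)` -/
  iso_koopman : ∀ (t : ℝ) (ψ : ZeroWavenumberSpace Z), iso (Z.koopman t ψ) = chaosKoopman ω₂ t (iso ψ)
  /-- `ι Θ = Θ ι` -/
  iso_reversal : ∀ ψ : ZeroWavenumberSpace Z,
    iso (Z.reversal hasMomentumReversal ψ) = chaosReversal (iso ψ)
  /-- the range of `ι` is a real form: complex inner products of images are real -/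
  im_inner_iso : ∀ ψ φ : ZeroWavenumberSpace Z, (⟪iso ψ, iso φ⟫_ℂ).im = 0
  /-- images are bosonic (symmetric kernels) -/
  iso_mem_chaosSymmetric : ∀ ψ : ZeroWavenumberSpace Z, iso ψ ∈ chaosSymmetric
  /-- `ι(ℋ₀) ⊕ i ι(ℋ₀) = 𝔉_sym`: the complexification of `ι` is onto the bosonic subspace -/
  exists_eq_iso_add_I_smul : ∀ Φ ∈ chaosSymmetric,
    ∃ ψ φ : ZeroWavenumberSpace Z, Φ = iso ψ + (Complex.I : ℂ) • iso φ
  /-- `ι[J]` is the `(1,1)`-vector with profile `T ω'` -/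
  iso_currentClass : iso Z.currentClass = currentVector ω₂ T
  /-- `ι[h]` is the `(1,1)`-vector with profile `T` -/
  iso_energyClass : iso Z.energyClass = energyVector T

namespace HarmonicChaosDecomposition

open HarmonicChaos

variable {ω₂ γ T : ℝ} (C : HarmonicChaosDecomposition ω₂ γ T)

/-- `ι` preserves inner products (`⟪·,·⟫_ℝ` on `𝔉` is `Re ⟪·,·⟫_ℂ`). [folklore] -/
theorem inner_iso_iso (ψ φ : ZeroWavenumberSpace C.Z) : ⟪C.iso ψ, C.iso φ⟫_ℝ = ⟪ψ, φ⟫_ℝ :=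
  C.iso.inner_map_map ψ φ

/-- The harmonic flow commutes with the shifts on the carrier. [folklore] -/
theorem flow_chainShift {σ : ChainConfig} (hσ : σ ∈ C.D.carrier) (t : ℝ) (x : ℤ) :
    C.D.flow t (chainShift x σ) = chainShift x (C.D.flow t σ) :=
  C.D.flow_chainShift C.carrier_shift hσ t x

/-- The harmonic flow is reversible on the carrier: `φ_t (R σ) = R (φ_{-t} σ)`. [folklore] -/
theorem flow_chainReversal {σ : ChainConfig} (hσ : σ ∈ C.D.carrier) (t : ℝ) :
    C.D.flow t (chainReversal σ) = chainReversal (C.D.flow (-t) σ) :=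
  C.D.flow_chainReversal C.carrier_reversal hσ t

/-- **`U_t [J] = [J]`**: the current class of the harmonic chain is invariant — it sits in the (infinitely
degenerate) eigenvalue `0` of the Liouvillian on `ℋ₀`; its spectral measure is a Drude atom. [cite: vanHemmen1980, §4] -/
theorem koopman_currentClass (t : ℝ) : C.Z.koopman t C.Z.currentClass = C.Z.currentClass :=
  C.iso.injective (by rw [C.iso_koopman, C.iso_currentClass, chaosKoopman_currentVector])

/-- `[J] ∈ 𝒬₀` (a conserved charge of the harmonic chain). [folklore] -/
theorem currentClass_mem_conservedSpace :
    C.Z.currentClass ∈ C.Z.toFluctuationDynamics.conservedSpace := fun t => C.koopman_currentClass t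

/-- **The harmonic chain is ballistic**: the Drude weight of the current is all of `‖[J]‖₀²`
(`= T² ∫ ω'² dk`). [folklore] -/
theorem currentDrudeWeight_eq : C.Z.currentDrudeWeight = ‖C.Z.currentClass‖ ^ 2 := by
  rw [ZeroWavenumberData.currentDrudeWeight, FluctuationDynamics.drudeWeight_def,
    FluctuationDynamics.hydroProjection_eq_self _ C.currentClass_mem_conservedSpace]
  rfl

/-- **`U_t [h] = [h]`**: the energy class is conserved in `ℋ₀`. [folklore] -/
theorem energyConserved : C.Z.EnergyConserved :=
  C.Z.energyConserved_iff.2 fun t =>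
    C.iso.injective (by rw [C.iso_koopman, C.iso_energyClass, chaosKoopman_energyVector])

/-- The current autocorrelation of the harmonic chain is constant: `⟪[J], U_t [J]⟫₀ = ‖[J]‖₀²`. [folklore] -/
theorem inner_currentClass_koopman (t : ℝ) :
    ⟪C.Z.currentClass, C.Z.koopman t C.Z.currentClass⟫_ℝ = ‖C.Z.currentClass‖ ^ 2 := by
  rw [C.koopman_currentClass, real_inner_self_eq_norm_sq]

/-- `ι P_odd = P_odd ι`. [folklore] -/
theorem iso_oddProj (ψ : ZeroWavenumberSpace C.Z) :
    C.iso (C.Z.oddProj C.hasMomentumReversal ψ) = chaosOddProj (C.iso ψ) := by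
  rw [ZeroWavenumberData.oddProj_apply, chaosOddProj_apply, C.iso.map_smul, map_sub, C.iso_reversal,
    RCLike.real_smul_eq_coe_smul (K := ℂ)]
  norm_num

/-- `ι P_even = P_even ι`. [folklore] -/
theorem iso_evenProj (ψ : ZeroWavenumberSpace C.Z) :
    C.iso (C.Z.evenProj C.hasMomentumReversal ψ) = chaosEvenProj (C.iso ψ) := by
  rw [ZeroWavenumberData.evenProj_apply, chaosEvenProj_apply, C.iso.map_smul, map_add, C.iso_reversal,
    RCLike.real_smul_eq_coe_smul (K := ℂ)]
  norm_num

/-- `ι[J]` is `Θ`-odd in `𝔉` (given `iso_currentClass`, this is `chaosReversal_currentVector`; here from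
`Θ[J] = −[J]` in `ℋ₀`, without positivity of `ω₂`). [folklore] -/
theorem chaosReversal_iso_currentClass :
    chaosReversal (C.iso C.Z.currentClass) = -C.iso C.Z.currentClass := by
  rw [← C.iso_reversal, C.Z.reversal_currentClass C.hasMomentumReversal, map_neg]

/-- **`‖[J]‖₀ = ‖T ω'‖_{L²(𝕋, dk)}`**: the static current susceptibility of the harmonic chain
(`Σ_x Cov(j_0, j_x) = T² ∫ sin²k/ω(k)² dk`). [folklore] -/
theorem norm_currentClass : ‖C.Z.currentClass‖ = ‖toL2C μ𝕋 (currentProfile ω₂ T)‖ := by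
  rw [← C.iso.norm_map, C.iso_currentClass, currentVector, norm_onePhononVector]

/-- `‖[h]‖₀ = ‖T‖_{L²(𝕋, dk)}` (`Σ_x Cov(h_0, h_x) = T²`, the classical specific heat identity). [folklore] -/
theorem norm_energyClass : ‖C.Z.energyClass‖ = ‖toL2C μ𝕋 (energyProfile T)‖ := by
  rw [← C.iso.norm_map, C.iso_energyClass, energyVector, norm_onePhononVector]

end HarmonicChaosDecomposition

end Literature.MathematicalPhysics.KineticTheory.HeatConduction
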